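import Literature.Barriers.CriticalPhenomena.PlaquetteWalkIsthmusDefect
import Literature.Barriers.CriticalPhenomena.PlaquetteWalkSeparatedExits
import HarnessLib

/-!
# Isthmus hole roots, Part 4: the isthmus dichotomy — genuine holes of arbitrary shape

Companion leaf of `PlaquetteWalkIsthmusRoot.lean` (Parts 1/2, p364093/p364995) and
`PlaquetteWalkIsthmusDefect.lean` (Part 3, p368715) of the barrier catalogue (venture lane «pcv-sawmu»,
Tier B, seat b-step0). Setting of Parts 1–3: a finite face list `Dl`, a plaquette `w ∈ Dl`, a side `σ`
with the plaquette `nbr w σ` across it MISSING (so `a = w.side σ` is a boundary root) and the OPPOSITE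
side `w.side σ.opp` an OUTER root (`w` is a width-one isthmus). Part 3 proved the hole defect law
`VF_D(w.side σ, w) = 2·v(θ)·c_{σ̄}·B_θ(D,w,σ)` with `B ≥ 0` the total printed weight of the walks of
`D ∖ {w}` joining the two lateral sides of `w` (the «slot»), and `VF = 0 ↔ B = 0`; Part 3i exhibited
`B > 0` for the fully ringed single-plaquette hole.

This file settles the general case (`DESIGN-next.md`, item 1 — the digital-topology step):

* `nonempty_slot_of_not_outerRoot`: if the root `w.side σ` is NOT an outer root (the missing plaquette
  lies in a hole of `D`, of ARBITRARY shape), then some self-avoiding plaquette walk of `D ∖ {w}` joins the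
  two sides of the slot. Proof: boundary tracing. The darts of `ℤ²` with a plaquette of the hole
  (the king-connected component of `nbr w σ` in the complement of `D`) on their left and a plaquette
  outside the hole on their right form a finite set on which the «rightmost-first» successor is
  injective; the dart running under the missing plaquette is therefore periodic, the plaquettes on the
  right of its orbit (corner plaquettes inserted at left turns) form a closed edge-connected chain of
  plaquettes of `D` passing through `w` exactly ONCE — this is where `¬OuterRoot (w.side σ)` enters: the
  exterior plaquette across `σ.opp` is not in the hole — so the rest of the chain joins the two lateral
  neighbours of `w` inside `D ∖ {w}`; a shortest such chain carries one arc per plaquette and is packaged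
  by the tree's `YBWalk.ofFn`.
* `slotWeightSum_pos_of_not_outerRoot`: hence `B_θ(D,w,σ) > 0` for EVERY `θ` of the CLOSED printed range
  `[π/3, 2π/3]` (one arc per plaquette: only `u₁, u₂, v > 0` enter; `w₂(π/3) = 0` is harmless), and
* ★ `vertexFunctional_printed_isthmus_root_eq_zero_iff_outerRoot` — **the isthmus dichotomy**: for every
  `θ ∈ [π/3, 2π/3]`, every finite face list and every width-one isthmus, the Yang–Baxter vertex identity at
  the root plaquette HOLDS IFF the root lies on the OUTER boundary (`←` is the tree's C-B2
  `vertexFunctional_printed_eq_zero`); with Part 1 the identity then holds at every plaquette iff the root is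
  outer (`vertexFunctional_printed_isthmus_eq_zero_forall_iff_outerRoot`). The outer-root hypothesis of
  Duminil-Copin–Smirnov's Lemma 1 / Glazman–Manolescu's Lemma 2.1 is thus SHARP at every isthmus.
* `isEmpty_slot_iff_outerRoot`: the `θ`-free combinatorial form — no walk of `D ∖ {w}` crosses the slot iff
  the root is outer (`←` is Part 3b's pinch corollary, proved through the observable).

References: H. Duminil-Copin, S. Smirnov, Ann. of Math. 175 (2012), Lemma 1 and its proof («we used the
fact that a is on the boundary and Ω is simply connected», arXiv p. 4) [DuminilCopinSmirnov2012];
A. Glazman, I. Manolescu, arXiv:1708.00395v3, Lemma 2.1 [GlazmanManolescu2019]; A. Glazman, Electron.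
Commun. Probab. 20 (2015) no. 86, Lemma 3.1 [Glazman2015WeightedSAW]. The boundary-tracing lemma is the
square-lattice folklore of digital topology (edge-connectivity of a set is dual to king-connectivity of its
complement; printed forms: S. Friedli, Y. Velenik, *Statistical Mechanics of Lattice Systems*, CUP 2017,
App. B.15 «A result on the boundary of subsets of ℤ^d» [FriedliVelenik2017]; H. Kesten, *Percolation Theory
for Mathematicians*, 1982, §2.1/App. [Kesten1982]); it is proved here from scratch in the form needed.
Status in print: the dichotomy for hole roots is not located in print — NEW-IN-WRITING (modest), lane label
pending (lit-2).
-/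

noncomputable section

open Real

namespace Literature.Barriers.CriticalPhenomena.PlaquetteWalk

open Literature.Probability.RandomPlanarGeometry.SAW.YangBaxter
open Literature.Probability.RandomPlanarGeometry.SAW.YangBaxter.MidEdge
open Literature.Probability.RandomPlanarGeometry.SAW

/-! ### Plumbing (re-proved; private in the parents) -/

section Plumbing

variable {Dl : List Face} {w : Face} {σ : Side}

/-- A side's opposite's opposite. [folklore] -/
private theorem Side.opp_opp₄ (s : Side) : s.opp.opp = s := by cases s <;> rfl

/-- A side differs from its opposite. [folklore] -/
private theorem Side.opp_ne_self₄ (s : Side) : s.opp ≠ s := by cases s <;> decide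

/-- The lateral sides are neither `σ` nor its opposite. [folklore] -/
private theorem lat_facts₄ (σ : Side) :
    lat σ ≠ σ ∧ lat σ ≠ σ.opp ∧ (lat σ).opp ≠ σ ∧ (lat σ).opp ≠ σ.opp := by
  cases σ <;> decide

/-- Membership in the face list with `w` removed. [folklore] -/
private theorem mem_eraseFace₄ {Dl : List Face} {w f : Face} : f ∈ eraseFace Dl w ↔ f ∈ Dl ∧ f ≠ w := by
  simp [eraseFace]

/-- The shared side: the `s.opp` side of the plaquette across `s` is the `s` side of `f`. [folklore] -/
private theorem side_nbr_opp₄ (f : Face) (s : Side) : (nbr f s).side s.opp = f.side s := by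
  obtain ⟨x, y⟩ := f
  cases s <;> simp [nbr, Face.side, Side.opp]

/-- Across and back. [folklore] -/
private theorem nbr_nbr_opp₄ (f : Face) (s : Side) : nbr (nbr f s) s.opp = f := by
  obtain ⟨x, y⟩ := f
  cases s <;> simp [nbr, Side.opp]

/-- `nbr · s` is injective. [folklore] -/
private theorem nbr_inj₄ {f g : Face} {s : Side} (h : nbr f s = nbr g s) : f = g := by
  have := congrArg (fun x => nbr x s.opp) h
  simpa [nbr_nbr_opp₄] using this

/-- Moving across a side changes the plaquette. [folklore] -/
private theorem nbr_ne_self₄ (f : Face) (s : Side) : nbr f s ≠ f := by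
  obtain ⟨x, y⟩ := f
  cases s <;> simp [nbr]

/-- The two plaquettes of the side `s` of `w` are `w` and `nbr w s`. [folklore] -/
private theorem faces_side_eq₄ (w : Face) (s : Side) :
    (w.side s).faces = (nbr w s, w) ∨ (w.side s).faces = (w, nbr w s) := by
  obtain ⟨x, y⟩ := w
  cases s <;> simp [Face.side, MidEdge.faces, nbr]

/-- A plaquette having `w.side s` as one of its sides is `w` or the plaquette across. [folklore] -/
private theorem eq_or_eq_nbr_of_side_eq₄ {w f : Face} {s t : Side} (h : f.side t = w.side s) :
    f = w ∨ f = nbr w s := by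
  have h' := (Face.exists_side_eq_iff f (w.side s)).1 ⟨t, h⟩
  rcases faces_side_eq₄ w s with e | e <;> rw [e] at h' <;> tauto

/-- For an isthmus root the plaquette across the opposite side is outside the domain. [folklore] -/
private theorem nbr_opp_not_mem₄ (hw : w ∈ Dl) (hO : OuterRoot (dom Dl) (w.side σ.opp)) :
    nbr w σ.opp ∉ dom Dl := by
  obtain ⟨n, g, ⟨s₀, hs₀⟩, hD, -, -⟩ := hO
  rcases eq_or_eq_nbr_of_side_eq₄ hs₀ with h | h
  · exact absurd (h ▸ (hw : w ∈ dom Dl)) (hD 0 (Nat.zero_le _))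
  · exact h ▸ hD 0 (Nat.zero_le _)

/-- Two plaquettes at sup-distance `≤ 1` share a corner. [folklore] -/
private theorem exists_corner_of_near {f g : Face} (h1 : f.1 - g.1 ≤ 1) (h1' : g.1 - f.1 ≤ 1)
    (h2 : f.2 - g.2 ≤ 1) (h2' : g.2 - f.2 ≤ 1) : ∃ q : ℤ × ℤ, IsCornerOf q f ∧ IsCornerOf q g := by
  refine ⟨(max f.1 g.1, max f.2 g.2), ⟨?_, ?_⟩, ⟨?_, ?_⟩⟩
  · rcases le_total f.1 g.1 with h | h
    · rw [max_eq_right h]; omega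
    · rw [max_eq_left h]; omega
  · rcases le_total f.2 g.2 with h | h
    · rw [max_eq_right h]; omega
    · rw [max_eq_left h]; omega
  · rcases le_total f.1 g.1 with h | h
    · rw [max_eq_right h]; omega
    · rw [max_eq_left h]; omega
  · rcases le_total f.2 g.2 with h | h
    · rw [max_eq_right h]; omega
    · rw [max_eq_left h]; omega

end Plumbing

/-! ### The hole behind a root: the king-component of the missing plaquette in the complement -/

section Hole

variable {D : Set Face} {h f f' : Face}

/-- **The hole component** of the plaquette `h` relative to the domain `D`: the plaquettes joined to `h`
by a chain of plaquettes outside `D`, consecutive ones sharing a corner (king moves — the connectivity of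
the complement dual to the edge-connectivity of the walks, as in the tree's `ExteriorChain`).
[cite: DuminilCopinSmirnov2012, Lemma 1 (a ∈ ∂Ω, Ω simply connected: no hole behind the root)] -/
def holeComp (D : Set Face) (h : Face) : Set Face :=
  {f | ∃ (n : ℕ) (g : ℕ → Face), g 0 = h ∧ g n = f ∧ (∀ i ≤ n, g i ∉ D) ∧
    ∀ i < n, ∃ q : ℤ × ℤ, IsCornerOf q (g i) ∧ IsCornerOf q (g (i + 1))}

/-- The missing plaquette lies in its hole component. [folklore] -/
private theorem mem_holeComp_self (hh : h ∉ D) : h ∈ holeComp D h :=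
  ⟨0, fun _ => h, rfl, rfl, fun _ _ => hh, fun _ hi => absurd hi (Nat.not_lt_zero _)⟩

/-- The hole component avoids the domain. [folklore] -/
private theorem not_mem_of_mem_holeComp (hf : f ∈ holeComp D h) : f ∉ D := by
  obtain ⟨n, g, -, hn, hD, -⟩ := hf
  exact hn ▸ hD n le_rfl

/-- The hole component is closed under king moves inside the complement. [folklore] -/
private theorem mem_holeComp_of_corner (hf : f ∈ holeComp D h) (hq : ∃ q : ℤ × ℤ, IsCornerOf q f ∧ IsCornerOf q f')
    (hf' : f' ∉ D) : f' ∈ holeComp D h := by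
  obtain ⟨n, g, h0, hn, hD, hl⟩ := hf
  refine ⟨n + 1, fun i => if i ≤ n then g i else f', by simp [h0], by simp, ?_, ?_⟩
  · intro i hi
    dsimp only
    by_cases hi' : i ≤ n
    · rw [if_pos hi']; exact hD i hi'
    · rw [if_neg hi']; exact hf'
  · intro i hi
    dsimp only
    by_cases hi' : i < n
    · rw [if_pos hi'.le, if_pos (by omega)]; exact hl i hi'
    · have : i = n := by omega
      subst this
      rw [if_pos le_rfl, if_neg (by omega), hn]; exact hq

/-- Closure under king moves, coordinate form. [folklore] -/
private theorem mem_holeComp_of_near (hf : f ∈ holeComp D h) (h1 : f.1 - f'.1 ≤ 1) (h1' : f'.1 - f.1 ≤ 1)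
    (h2 : f.2 - f'.2 ≤ 1) (h2' : f'.2 - f.2 ≤ 1) (hf' : f' ∉ D) : f' ∈ holeComp D h :=
  mem_holeComp_of_corner hf (exists_corner_of_near h1 h1' h2 h2') hf'

/-- Contrapositive of the closure: a plaquette near the hole but not in it lies in the domain. [folklore] -/
private theorem mem_of_near_of_not_mem_holeComp (hf : f ∈ holeComp D h) (h1 : f.1 - f'.1 ≤ 1) (h1' : f'.1 - f.1 ≤ 1)
    (h2 : f.2 - f'.2 ≤ 1) (h2' : f'.2 - f.2 ≤ 1) (hf' : f' ∉ holeComp D h) : f' ∈ D := by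
  by_contra hD
  exact hf' (mem_holeComp_of_near hf h1 h1' h2 h2' hD)

/-- **If the hole component of the missing plaquette reaches a plaquette carrying an outer root, the root
behind the missing plaquette is itself an outer root** (concatenate the king chain with the exterior chain).
[cite: DuminilCopinSmirnov2012, Lemma 1 (a ∈ ∂Ω)] -/
theorem outerRoot_of_mem_holeComp {Dl : List Face} {w : Face} {σ : Side} (hw : w ∈ Dl)
    (hO : OuterRoot (dom Dl) (w.side σ.opp)) (ho : nbr w σ.opp ∈ holeComp (dom Dl) (nbr w σ)) :
    OuterRoot (dom Dl) (w.side σ) := by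
  obtain ⟨n, g, ⟨s₀, hs₀⟩, hD, hlink, hbey⟩ := hO
  have hg0 : g 0 = nbr w σ.opp := by
    rcases eq_or_eq_nbr_of_side_eq₄ hs₀ with e | e
    · exact absurd (e ▸ (hw : w ∈ dom Dl)) (hD 0 (Nat.zero_le _))
    · exact e
  obtain ⟨m, k, hk0, hkm, hkD, hkl⟩ := ho
  set G : ℕ → Face := fun i => if i ≤ m then k i else g (i - m) with hG
  have hG_le : ∀ i ≤ m, G i = k i := fun i hi => by simp only [hG, if_pos hi]
  have hG_gt : ∀ i, m < i → G i = g (i - m) := fun i hi => by simp only [hG, if_neg (not_le.2 hi)]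
  have hGlast : G (m + n) = g n := by
    by_cases hn : n = 0
    · subst hn; rw [Nat.add_zero, hG_le m le_rfl, hkm, hg0]
    · rw [hG_gt (m + n) (by omega), show m + n - m = n from by omega]
  refine ⟨m + n, G, ⟨σ.opp, ?_⟩, ?_, ?_, ?_⟩
  · rw [hG_le 0 (Nat.zero_le _), hk0]
    exact side_nbr_opp₄ w σ
  · intro i hi
    by_cases him : i ≤ m
    · rw [hG_le i him]; exact hkD i him
    · rw [hG_gt i (by omega)]; exact hD (i - m) (by omega)
  · intro i hi
    by_cases him : i < m
    · rw [hG_le i him.le, hG_le (i + 1) (by omega)]; exact hkl i him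
    · by_cases hie : i = m
      · subst hie
        rw [hG_le i le_rfl, hkm, ← hg0, hG_gt (i + 1) (by omega), show i + 1 - i = 0 + 1 from by omega]
        exact hlink 0 (by omega)
      · rw [hG_gt i (by omega), hG_gt (i + 1) (by omega), show i + 1 - m = (i - m) + 1 from by omega]
        exact hlink (i - m) (by omega)
  · rw [hGlast]
    exact hbey

/-- King adjacency in coordinates (sup-distance at most one; reflexive): the linkage of exterior chains.
[cite: DuminilCopinSmirnov2012, Lemma 1 (a ∈ ∂Ω: the root on the outer boundary)] -/
def Near : Face → Face → Prop
  | (a, b), (c, d) => a - c ≤ 1 ∧ c - a ≤ 1 ∧ b - d ≤ 1 ∧ d - b ≤ 1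

/-- Closure of the hole component under king moves, coordinate form. [folklore] -/
private theorem mem_holeComp_of_Near (hf : f ∈ holeComp D h) (hn : Near f f') (hf' : f' ∉ D) :
    f' ∈ holeComp D h := by
  obtain ⟨a, b⟩ := f
  obtain ⟨c, d⟩ := f'
  simp only [Near] at hn
  exact mem_holeComp_of_near hf (by dsimp only; omega) (by dsimp only; omega) (by dsimp only; omega)
    (by dsimp only; omega) hf'

/-- A plaquette king-adjacent to the hole but not in it lies in the domain. [folklore] -/
private theorem mem_of_Near_of_not_mem_holeComp (hf : f ∈ holeComp D h) (hn : Near f f') (hf' : f' ∉ holeComp D h) :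
    f' ∈ D := by
  by_contra hD
  exact hf' (mem_holeComp_of_Near hf hn hD)

end Hole

/-! ### Darts and the rightmost-first boundary tracing -/

section Darts

/-- The unit step of a heading (`W, E, S, N` = `−x, +x, −y, +y`). [folklore] -/
def step : Side → ℤ × ℤ
  | .W => (-1, 0)
  | .E => (1, 0)
  | .S => (0, -1)
  | .N => (0, 1)

/-- Right turn of a heading. [folklore] -/
def cw : Side → Side
  | .E => .S
  | .S => .W
  | .W => .N
  | .N => .E

/-- Left turn of a heading. [folklore] -/
def ccw : Side → Side
  | .E => .N
  | .N => .W
  | .W => .S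
  | .S => .E

/-- The plaquette north-east of the lattice point `u` (lower-left corner `u`). [folklore] -/
def pNE (u : ℤ × ℤ) : Face := (u.1, u.2)
/-- The plaquette north-west of the lattice point `u`. [folklore] -/
def pNW (u : ℤ × ℤ) : Face := (u.1 - 1, u.2)
/-- The plaquette south-west of the lattice point `u`. [folklore] -/
def pSW (u : ℤ × ℤ) : Face := (u.1 - 1, u.2 - 1)
/-- The plaquette south-east of the lattice point `u`. [folklore] -/
def pSE (u : ℤ × ℤ) : Face := (u.1, u.2 - 1)

/-- Left plaquette of the dart ARRIVING at `u` with heading `d`. [folklore] -/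
def lfIn (u : ℤ × ℤ) : Side → Face
  | .N => pSW u
  | .E => pNW u
  | .S => pNE u
  | .W => pSE u

/-- Right plaquette of the dart arriving at `u` with heading `d`. [folklore] -/
def rtIn (u : ℤ × ℤ) : Side → Face
  | .N => pSE u
  | .E => pSW u
  | .S => pNW u
  | .W => pNE u

/-- Left plaquette of the dart LEAVING `u` with heading `d`. [folklore] -/
def lfOut (u : ℤ × ℤ) : Side → Face
  | .N => pNW u
  | .E => pNE u
  | .S => pSE u
  | .W => pSW u

/-- Right plaquette of the dart leaving `u` with heading `d`. [folklore] -/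
def rtOut (u : ℤ × ℤ) : Side → Face
  | .N => pNE u
  | .E => pSE u
  | .S => pSW u
  | .W => pNW u

/-- The right plaquette of the right turn is the old right plaquette. [folklore] -/
private theorem rtOut_cw (u : ℤ × ℤ) (d : Side) : rtOut u (cw d) = rtIn u d := by cases d <;> rfl

/-- The left plaquette of the right turn is the front-right plaquette. [folklore] -/
private theorem lfOut_cw (u : ℤ × ℤ) (d : Side) : lfOut u (cw d) = rtOut u d := by cases d <;> rfl

/-- The left plaquette of the left turn is the old left plaquette. [folklore] -/
private theorem lfOut_ccw (u : ℤ × ℤ) (d : Side) : lfOut u (ccw d) = lfIn u d := by cases d <;> rfl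

/-- The right plaquette of the left turn is the front-left plaquette. [folklore] -/
private theorem rtOut_ccw (u : ℤ × ℤ) (d : Side) : rtOut u (ccw d) = lfOut u d := by cases d <;> rfl

/-- After the step, the left plaquette seen from the new head is the one seen from the old head. [folklore] -/
private theorem lfIn_add_step (u : ℤ × ℤ) (d : Side) : lfIn (u + step d) d = lfOut u d := by
  obtain ⟨x, y⟩ := u
  cases d <;> simp [lfIn, lfOut, step, pNE, pNW, pSW, pSE] <;> omega

/-- After the step, the right plaquette seen from the new head is the one seen from the old head. [folklore] -/
private theorem rtIn_add_step (u : ℤ × ℤ) (d : Side) : rtIn (u + step d) d = rtOut u d := by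
  obtain ⟨x, y⟩ := u
  cases d <;> simp [rtIn, rtOut, step, pNE, pNW, pSW, pSE] <;> omega

/-- `cw` then `ccw`. [folklore] -/
private theorem ccw_cw (d : Side) : ccw (cw d) = d := by cases d <;> rfl

/-- `ccw` then `cw`. [folklore] -/
private theorem cw_ccw (d : Side) : cw (ccw d) = d := by cases d <;> rfl

variable (H : Set Face)

open Classical in
/-- **The rightmost-first rule** at the head `u` of a dart with heading `d`: turn right if the front-right
plaquette is in the hole, else go straight if the front-left one is, else turn left. [folklore] -/
def turn (u : ℤ × ℤ) (d : Side) : Side :=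
  if rtOut u d ∈ H then cw d else if lfOut u d ∈ H then d else ccw d

/-- A boundary dart (arriving at `u` with heading `d`): hole on the left, not on the right — a unit piece
of the interface between the hole and the domain. [cite: DuminilCopinSmirnov2012, Lemma 1 (∂Ω: the boundary mid-edges of the domain)] -/
def InB (e : (ℤ × ℤ) × Side) : Prop := lfIn e.1 e.2 ∈ H ∧ rtIn e.1 e.2 ∉ H

/-- The successor dart: turn by the rightmost-first rule and advance one step. [folklore] -/
def nextRaw (e : (ℤ × ℤ) × Side) : (ℤ × ℤ) × Side := (e.1 + step (turn H e.1 e.2), turn H e.1 e.2)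

variable {H}

/-- The three cases of the rule, with what each case knows. [folklore] -/
private theorem turn_cases (u : ℤ × ℤ) (d : Side) :
    (turn H u d = cw d ∧ rtOut u d ∈ H) ∨ (turn H u d = d ∧ rtOut u d ∉ H ∧ lfOut u d ∈ H) ∨
      (turn H u d = ccw d ∧ rtOut u d ∉ H ∧ lfOut u d ∉ H) := by
  unfold turn
  by_cases h1 : rtOut u d ∈ H
  · exact Or.inl ⟨by rw [if_pos h1], h1⟩
  · by_cases h2 : lfOut u d ∈ H
    · exact Or.inr (Or.inl ⟨by rw [if_neg h1, if_pos h2], h1, h2⟩)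
    · exact Or.inr (Or.inr ⟨by rw [if_neg h1, if_neg h2], h1, h2⟩)

/-- The dart leaving `u` along the chosen heading has the hole on its left and not on its right. [folklore] -/
private theorem lfOut_turn_mem {u : ℤ × ℤ} {d : Side} (he : InB H (u, d)) :
    lfOut u (turn H u d) ∈ H ∧ rtOut u (turn H u d) ∉ H := by
  obtain ⟨hl, hr⟩ := he
  rcases turn_cases (H := H) u d with ⟨e, h1⟩ | ⟨e, h1, h2⟩ | ⟨e, h1, h2⟩ <;> rw [e]
  · exact ⟨by rwa [lfOut_cw], by rwa [rtOut_cw]⟩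
  · exact ⟨h2, h1⟩
  · exact ⟨by rwa [lfOut_ccw], by rwa [rtOut_ccw]⟩

/-- **The successor of a boundary dart is a boundary dart.** [folklore] -/
private theorem inB_nextRaw {e : (ℤ × ℤ) × Side} (he : InB H e) : InB H (nextRaw H e) := by
  obtain ⟨u, d⟩ := e
  obtain ⟨h1, h2⟩ := lfOut_turn_mem he
  exact ⟨by unfold nextRaw; rwa [lfIn_add_step], by unfold nextRaw; rwa [rtIn_add_step]⟩

/-- Two boundary darts arriving at the same lattice point with different headings choose different
headings (perpendicular arrivals cannot both be boundary darts; opposite arrivals form the checkerboard and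
turn away from each other). [folklore] -/
private theorem turn_inj {u : ℤ × ℤ} {d d' : Side} (hd : InB H (u, d)) (hd' : InB H (u, d'))
    (h : turn H u d = turn H u d') : d = d' := by
  obtain ⟨hl, hr⟩ := hd
  obtain ⟨hl', hr'⟩ := hd'
  rcases turn_cases (H := H) u d with ⟨e, h1⟩ | ⟨e, h1, h2⟩ | ⟨e, h1, h2⟩ <;>
  rcases turn_cases (H := H) u d' with ⟨e', h1'⟩ | ⟨e', h1', h2'⟩ | ⟨e', h1', h2'⟩ <;>
  rw [e, e'] at h <;>
  cases d <;> cases d' <;>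
  simp only [cw, ccw, lfIn, rtIn, lfOut, rtOut, reduceCtorEq] at * <;>
  first
  | rfl
  | exact absurd ‹pNE u ∈ H› ‹pNE u ∉ H›
  | exact absurd ‹pNW u ∈ H› ‹pNW u ∉ H›
  | exact absurd ‹pSW u ∈ H› ‹pSW u ∉ H›
  | exact absurd ‹pSE u ∈ H› ‹pSE u ∉ H›

/-- `step` is injective. [folklore] -/
private theorem step_inj {d d' : Side} (h : step d = step d') : d = d' := by
  cases d <;> cases d' <;> simp [step] at h ⊢

/-- **The successor map is injective on boundary darts.** [folklore] -/
private theorem nextRaw_inj {e e' : (ℤ × ℤ) × Side} (he : InB H e) (he' : InB H e') (h : nextRaw H e = nextRaw H e') :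
    e = e' := by
  obtain ⟨u, d⟩ := e
  obtain ⟨u', d'⟩ := e'
  simp only [nextRaw, Prod.mk.injEq] at h
  obtain ⟨hu, ht⟩ := h
  rw [ht] at hu
  have hu' : u = u' := by
    have := congrArg (fun x => x - step (turn H u' d')) hu
    simpa using this
  subst hu'
  rw [turn_inj he he' ht]

end Darts

/-! ### Lattice geometry of darts -/

section DartGeometry

/-- The right plaquette determines the head, for a fixed heading. [folklore] -/
private theorem rtIn_inj {u u' : ℤ × ℤ} {d : Side} (h : rtIn u d = rtIn u' d) : u = u' := by
  obtain ⟨x, y⟩ := u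
  obtain ⟨x', y'⟩ := u'
  cases d <;> simp [rtIn, pNE, pNW, pSW, pSE, Prod.mk.injEq] at h ⊢ <;> omega

/-- The left plaquette is across the travelled edge from the right plaquette. [folklore] -/
private theorem lfIn_eq_nbr_rtIn (u : ℤ × ℤ) (d : Side) : lfIn u d = nbr (rtIn u d) (ccw d) := by
  obtain ⟨x, y⟩ := u
  cases d <;> simp [lfIn, rtIn, nbr, ccw, pNE, pNW, pSW, pSE]

/-- The front-right plaquette is ahead of the right plaquette. [folklore] -/
private theorem rtOut_eq_nbr_rtIn (u : ℤ × ℤ) (d : Side) : rtOut u d = nbr (rtIn u d) d := by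
  obtain ⟨x, y⟩ := u
  cases d <;> simp [rtOut, rtIn, nbr, pNE, pNW, pSW, pSE]

/-- The front-left plaquette is to the left of the front-right one. [folklore] -/
private theorem lfOut_eq_nbr_rtOut (u : ℤ × ℤ) (d : Side) : lfOut u d = nbr (rtOut u d) (ccw d) := by
  obtain ⟨x, y⟩ := u
  cases d <;> simp [lfOut, rtOut, nbr, ccw, pNE, pNW, pSW, pSE]

/-- The front-left plaquette is ahead of the left plaquette. [folklore] -/
private theorem lfOut_eq_nbr_lfIn (u : ℤ × ℤ) (d : Side) : lfOut u d = nbr (lfIn u d) d := by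
  obtain ⟨x, y⟩ := u
  cases d <;> simp [lfOut, lfIn, nbr, pNE, pNW, pSW, pSE]

/-- Left and right plaquettes are king-adjacent. [folklore] -/
private theorem near_lfIn_rtIn (u : ℤ × ℤ) (d : Side) : Near (lfIn u d) (rtIn u d) := by
  obtain ⟨x, y⟩ := u
  cases d <;> simp only [Near, lfIn, rtIn, pNE, pNW, pSW, pSE] <;> omega

/-- Left and front-right plaquettes are king-adjacent (diagonally). [folklore] -/
private theorem near_lfIn_rtOut (u : ℤ × ℤ) (d : Side) : Near (lfIn u d) (rtOut u d) := by
  obtain ⟨x, y⟩ := u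
  cases d <;> simp only [Near, lfIn, rtOut, pNE, pNW, pSW, pSE] <;> omega

/-- Left and front-left plaquettes are king-adjacent. [folklore] -/
private theorem near_lfIn_lfOut (u : ℤ × ℤ) (d : Side) : Near (lfIn u d) (lfOut u d) := by
  obtain ⟨x, y⟩ := u
  cases d <;> simp only [Near, lfIn, lfOut, pNE, pNW, pSW, pSE] <;> omega

/-- `nbr w ·` is injective. [folklore] -/
private theorem nbr_side_inj {w : Face} {s s' : Side} (h : nbr w s = nbr w s') : s = s' := by
  obtain ⟨x, y⟩ := w
  cases s <;> cases s' <;> simp [nbr, Prod.mk.injEq] at h ⊢ <;> omega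

/-- The four sides around `σ`. [folklore] -/
private theorem side_cases₄ (σ s : Side) : s = σ ∨ s = σ.opp ∨ s = lat σ ∨ s = (lat σ).opp := by
  cases σ <;> cases s <;> decide

/-- The right turn from `σ` is a lateral side. [folklore] -/
private theorem cw_lateral (σ : Side) : (cw σ = lat σ ∧ (cw σ).opp = (lat σ).opp) ∨
    (cw σ = (lat σ).opp ∧ (cw σ).opp = lat σ) := by
  cases σ <;> decide

/-- The right turn from `σ` is neither `σ` nor its opposite. [folklore] -/
private theorem cw_ne (σ : Side) : cw σ ≠ σ ∧ cw σ ≠ σ.opp := by cases σ <;> decide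

/-- Nor is its opposite. [folklore] -/
private theorem cw_opp_ne (σ : Side) : (cw σ).opp ≠ σ ∧ (cw σ).opp ≠ σ.opp := by cases σ <;> decide

/-- The head of the root dart: the dart along the edge between the missing plaquette `nbr w σ` (on its
left) and `w` (on its right) arrives at this corner of `w` with heading `cw σ`. [folklore] -/
def rootHead (w : Face) : Side → ℤ × ℤ
  | .N => (w.1 + 1, w.2 + 1)
  | .S => (w.1, w.2)
  | .E => (w.1 + 1, w.2)
  | .W => (w.1, w.2 + 1)

/-- The root dart has `w` on its right. [folklore] -/
private theorem rtIn_rootHead (w : Face) (σ : Side) : rtIn (rootHead w σ) (cw σ) = w := by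
  obtain ⟨x, y⟩ := w
  cases σ <;> simp [rtIn, rootHead, cw, pNE, pNW, pSW, pSE]

/-- The root dart has the missing plaquette on its left. [folklore] -/
private theorem lfIn_rootHead (w : Face) (σ : Side) : lfIn (rootHead w σ) (cw σ) = nbr w σ := by
  rw [lfIn_eq_nbr_rtIn, rtIn_rootHead, ccw_cw]

/-- The plaquette ahead of the root dart is the lateral neighbour `nbr w (cw σ)`. [folklore] -/
private theorem rtOut_rootHead (w : Face) (σ : Side) : rtOut (rootHead w σ) (cw σ) = nbr w (cw σ) := by
  rw [rtOut_eq_nbr_rtIn, rtIn_rootHead]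

/-- Lateral neighbours are king-adjacent to the plaquettes across `σ` and across `σ.opp`. [folklore] -/
private theorem near_nbr_of_lateral (w : Face) (σ : Side) {s : Side} (hs : s ≠ σ) (hs' : s ≠ σ.opp) (τ : Side)
    (hτ : τ = σ ∨ τ = σ.opp) : Near (nbr w τ) (nbr w s) := by
  obtain ⟨x, y⟩ := w
  cases σ <;> simp only [Side.opp] at hτ hs' <;> rcases hτ with rfl | rfl <;> cases s <;>
    simp only [ne_eq, not_true_eq_false, reduceCtorEq, not_false_eq_true] at hs hs' <;>
    simp only [Near, nbr] <;> omega

end DartGeometry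

/-! ### The setting: an isthmus whose root is not on the outer boundary -/

section Setting

variable {Dl : List Face} {w : Face} {σ : Side}

/-- The hole behind the root `w.side σ`: the hole component of the missing plaquette. [cite: DuminilCopinSmirnov2012, Lemma 1 (Ω simply connected)] -/
abbrev hole (Dl : List Face) (w : Face) (σ : Side) : Set Face := holeComp (dom Dl) (nbr w σ)

/-- The missing plaquette is in the hole. [folklore] -/
private theorem nbr_mem_hole (hh : nbr w σ ∉ dom Dl) : nbr w σ ∈ hole Dl w σ := mem_holeComp_self hh

/-- A hole plaquette is outside the domain. [folklore] -/
private theorem not_mem_dom_of_mem_hole {f : Face} (hf : f ∈ hole Dl w σ) : f ∉ dom Dl := not_mem_of_mem_holeComp hf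

/-- `w` itself is not in the hole. [folklore] -/
private theorem self_not_mem_hole (hw : w ∈ Dl) : w ∉ hole Dl w σ := fun h => not_mem_of_mem_holeComp h hw

/-- **Where `¬OuterRoot` enters**: the exterior plaquette across `σ.opp` is not in the hole. [cite: DuminilCopinSmirnov2012, Lemma 1 (a ∈ ∂Ω)] -/
private theorem opp_not_mem_hole (hw : w ∈ Dl) (hO : OuterRoot (dom Dl) (w.side σ.opp))
    (hn : ¬OuterRoot (dom Dl) (w.side σ)) : nbr w σ.opp ∉ hole Dl w σ :=
  fun ho => hn (outerRoot_of_mem_holeComp hw hO ho)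

/-- The lateral neighbours of `w` are in the domain (else the hole would reach the exterior plaquette).
[folklore] -/
private theorem lateral_mem_dom (hw : w ∈ Dl) (hh : nbr w σ ∉ dom Dl) (hO : OuterRoot (dom Dl) (w.side σ.opp))
    (hn : ¬OuterRoot (dom Dl) (w.side σ)) {s : Side} (hs : s ≠ σ) (hs' : s ≠ σ.opp) : nbr w s ∈ dom Dl := by
  by_contra hD
  have h1 : nbr w s ∈ hole Dl w σ :=
    mem_holeComp_of_Near (nbr_mem_hole hh) (near_nbr_of_lateral w σ hs hs' σ (Or.inl rfl)) hD
  have h2 : nbr w σ.opp ∈ hole Dl w σ := by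
    refine mem_holeComp_of_Near h1 ?_ (nbr_opp_not_mem₄ hw hO)
    have := near_nbr_of_lateral w σ hs hs' σ.opp (Or.inr rfl)
    obtain ⟨x, y⟩ := w
    revert this
    cases s <;> cases σ <;> simp only [Near, nbr, Side.opp] <;> omega
  exact opp_not_mem_hole hw hO hn h2

/-- The lateral neighbours of `w` are not in the hole. [folklore] -/
private theorem lateral_not_mem_hole (hw : w ∈ Dl) (hh : nbr w σ ∉ dom Dl) (hO : OuterRoot (dom Dl) (w.side σ.opp))
    (hn : ¬OuterRoot (dom Dl) (w.side σ)) {s : Side} (hs : s ≠ σ) (hs' : s ≠ σ.opp) : nbr w s ∉ hole Dl w σ :=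
  fun h => not_mem_dom_of_mem_hole h (lateral_mem_dom hw hh hO hn hs hs')

/-- A neighbour of `w` in the hole is the missing plaquette. [folklore] -/
private theorem eq_of_nbr_mem_hole (hw : w ∈ Dl) (hh : nbr w σ ∉ dom Dl) (hO : OuterRoot (dom Dl) (w.side σ.opp))
    (hn : ¬OuterRoot (dom Dl) (w.side σ)) {s : Side} (hs : nbr w s ∈ hole Dl w σ) : s = σ := by
  rcases side_cases₄ σ s with e | e | e | e
  · exact e
  · exact absurd (e ▸ hs) (opp_not_mem_hole hw hO hn)
  · exact absurd hs (e ▸ lateral_not_mem_hole hw hh hO hn (lat_facts₄ σ).1 (lat_facts₄ σ).2.1)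
  · exact absurd hs (e ▸ lateral_not_mem_hole hw hh hO hn (lat_facts₄ σ).2.2.1 (lat_facts₄ σ).2.2.2)

/-- The root dart is a boundary dart of the hole. [folklore] -/
private theorem inB_root (hw : w ∈ Dl) (hh : nbr w σ ∉ dom Dl) : InB (hole Dl w σ) (rootHead w σ, cw σ) :=
  ⟨by rw [lfIn_rootHead]; exact nbr_mem_hole hh, by rw [rtIn_rootHead]; exact self_not_mem_hole hw⟩

/-- **`w` occurs once**: the only boundary dart of the hole with `w` on its right is the root dart. [folklore] -/
private theorem eq_root_of_rtIn_eq (hw : w ∈ Dl) (hh : nbr w σ ∉ dom Dl) (hO : OuterRoot (dom Dl) (w.side σ.opp))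
    (hn : ¬OuterRoot (dom Dl) (w.side σ)) {u : ℤ × ℤ} {d : Side} (he : InB (hole Dl w σ) (u, d))
    (hr : rtIn u d = w) : (u, d) = (rootHead w σ, cw σ) := by
  have hl := he.1
  dsimp only at hl
  rw [lfIn_eq_nbr_rtIn, hr] at hl
  have hd : ccw d = σ := eq_of_nbr_mem_hole hw hh hO hn hl
  have hd' : d = cw σ := by rw [← hd, cw_ccw]
  subst hd'
  rw [← rtIn_rootHead w σ] at hr
  rw [rtIn_inj hr]

/-- The right plaquette of a boundary dart of the hole is in the domain. [folklore] -/
private theorem rtIn_mem_dom {u : ℤ × ℤ} {d : Side} (he : InB (hole Dl w σ) (u, d)) : rtIn u d ∈ dom Dl :=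
  mem_of_Near_of_not_mem_holeComp he.1 (near_lfIn_rtIn u d) he.2

/-- A front-right plaquette outside the hole is in the domain. [folklore] -/
private theorem rtOut_mem_dom {u : ℤ × ℤ} {d : Side} (he : InB (hole Dl w σ) (u, d)) (h1 : rtOut u d ∉ hole Dl w σ) :
    rtOut u d ∈ dom Dl :=
  mem_of_Near_of_not_mem_holeComp he.1 (near_lfIn_rtOut u d) h1

/-- A front-left plaquette outside the hole is in the domain. [folklore] -/
private theorem lfOut_mem_dom {u : ℤ × ℤ} {d : Side} (he : InB (hole Dl w σ) (u, d)) (h2 : lfOut u d ∉ hole Dl w σ) :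
    lfOut u d ∈ dom Dl :=
  mem_of_Near_of_not_mem_holeComp he.1 (near_lfIn_lfOut u d) h2

/-- **The corner plaquette of a left turn is never `w`**: at a left turn the left plaquette (in the hole) is
diagonal to the corner plaquette while the two plaquettes edge-adjacent to both are outside the hole; at `w`
the hole plaquette `nbr w σ` would be one of those two, or the exterior plaquette would join the hole.
[folklore] -/
private theorem rtOut_ne_self (hw : w ∈ Dl) (hh : nbr w σ ∉ dom Dl) (hO : OuterRoot (dom Dl) (w.side σ.opp))
    (hn : ¬OuterRoot (dom Dl) (w.side σ)) {u : ℤ × ℤ} {d : Side} (he : InB (hole Dl w σ) (u, d))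
    (h1 : rtOut u d ∉ hole Dl w σ) (h2 : lfOut u d ∉ hole Dl w σ) : rtOut u d ≠ w := by
  intro heq
  have hhH := nbr_mem_hole hh
  have ho := opp_not_mem_hole hw hO hn
  have hoD := nbr_opp_not_mem₄ hw hO
  obtain ⟨hl, hr⟩ := he
  dsimp only at hl hr
  obtain ⟨x, y⟩ := w
  obtain ⟨a, b⟩ := u
  cases d <;> simp only [rtOut, pNE, pNW, pSW, pSE, Prod.mk.injEq] at heq <;> obtain ⟨rfl, rfl⟩ := heq <;>
    cases σ <;> simp [hole, lfIn, rtIn, lfOut, pNE, pNW, pSW, pSE, nbr, Side.opp] at hl hr h2 hhH ho hoD <;>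
    first
    | exact hr hhH
    | exact h2 hhH
    | exact ho (mem_holeComp_of_Near hl (by simp only [Near]; omega) hoD)

end Setting

/-! ### The orbit of the root dart: periodicity -/

section Orbit

variable {Dl : List Face} {w : Face} {σ : Side}

/-- The orbit of the root dart under the rightmost-first successor. [folklore] -/
def orbit (Dl : List Face) (w : Face) (σ : Side) (k : ℕ) : (ℤ × ℤ) × Side :=
  (nextRaw (hole Dl w σ))^[k] (rootHead w σ, cw σ)

/-- The orbit starts at the root dart. [folklore] -/
private theorem orbit_zero : orbit Dl w σ 0 = (rootHead w σ, cw σ) := rfl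

/-- One more step of the orbit. [folklore] -/
private theorem orbit_succ (k : ℕ) : orbit Dl w σ (k + 1) = nextRaw (hole Dl w σ) (orbit Dl w σ k) :=
  Function.iterate_succ_apply' _ _ _

/-- Every dart of the orbit is a boundary dart of the hole. [folklore] -/
private theorem inB_orbit (hw : w ∈ Dl) (hh : nbr w σ ∉ dom Dl) (k : ℕ) : InB (hole Dl w σ) (orbit Dl w σ k) := by
  induction k with
  | zero => exact inB_root hw hh
  | succ k ih => rw [orbit_succ]; exact inB_nextRaw ih

/-- The boundary darts of the hole form a finite set (their right plaquettes lie in the finite domain).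
[folklore] -/
private theorem finite_inB : {e : (ℤ × ℤ) × Side | InB (hole Dl w σ) e}.Finite := by
  refine Set.Finite.of_finite_image (f := fun e : (ℤ × ℤ) × Side => (rtIn e.1 e.2, e.2)) ?_ ?_
  · refine Set.Finite.subset ((List.finite_toSet Dl).prod (Set.finite_univ (α := Side))) ?_
    rintro _ ⟨⟨u, d⟩, he, rfl⟩
    exact Set.mk_mem_prod (rtIn_mem_dom he) (Set.mem_univ _)
  · rintro ⟨u, d⟩ _ ⟨u', d'⟩ _ h
    simp only [Prod.mk.injEq] at h
    obtain ⟨h1, rfl⟩ := h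
    rw [rtIn_inj h1]

/-- Iterates of the successor are injective on boundary darts. [folklore] -/
private theorem iterate_cancel (H : Set Face) : ∀ (i : ℕ) {a b : (ℤ × ℤ) × Side}, InB H a → InB H b →
    (nextRaw H)^[i] a = (nextRaw H)^[i] b → a = b
  | 0, _, _, _, _, h => h
  | i + 1, _, _, ha, hb, h => by
    rw [Function.iterate_succ_apply, Function.iterate_succ_apply] at h
    exact nextRaw_inj ha hb (iterate_cancel H i (inB_nextRaw ha) (inB_nextRaw hb) h)

/-- **The root dart is periodic** (pigeonhole on the finite set of boundary darts plus injectivity).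
[folklore] -/
private theorem exists_period (hw : w ∈ Dl) (hh : nbr w σ ∉ dom Dl) :
    ∃ N, 0 < N ∧ orbit Dl w σ N = orbit Dl w σ 0 := by
  haveI : Finite {e : (ℤ × ℤ) × Side | InB (hole Dl w σ) e} := finite_inB.to_subtype
  let F : ℕ → {e : (ℤ × ℤ) × Side | InB (hole Dl w σ) e} := fun k => ⟨orbit Dl w σ k, inB_orbit hw hh k⟩
  obtain ⟨i, j, hij, hF⟩ := Finite.exists_ne_map_eq_of_infinite F
  have hF' : orbit Dl w σ i = orbit Dl w σ j := congrArg Subtype.val hF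
  have key : ∀ {i j : ℕ}, i < j → orbit Dl w σ i = orbit Dl w σ j → orbit Dl w σ (j - i) = orbit Dl w σ 0 := by
    intro i j h e
    have e1 : orbit Dl w σ j = (nextRaw (hole Dl w σ))^[i] (orbit Dl w σ (j - i)) := by
      unfold orbit
      rw [← Function.iterate_add_apply, show i + (j - i) = j from by omega]
    have e2 : orbit Dl w σ i = (nextRaw (hole Dl w σ))^[i] (orbit Dl w σ 0) := by
      unfold orbit; rfl
    rw [e1, e2] at e
    exact (iterate_cancel _ i (inB_orbit hw hh 0) (inB_orbit hw hh (j - i)) e).symm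
  rcases lt_or_gt_of_ne hij with h | h
  · exact ⟨j - i, by omega, key h hF'⟩
  · exact ⟨i - j, by omega, key h hF'.symm⟩

/-- The successor moves the head: no dart is fixed. [folklore] -/
private theorem nextRaw_ne_self (H : Set Face) (e : (ℤ × ℤ) × Side) : nextRaw H e ≠ e := by
  obtain ⟨⟨x, y⟩, d⟩ := e
  intro h
  simp only [nextRaw, Prod.mk.injEq] at h
  obtain ⟨h1, h2⟩ := h
  rw [h2] at h1
  cases d <;> simp [step] at h1

end Orbit

/-! ### Edge-connectivity of the right plaquettes of the orbit inside `D ∖ {w}` -/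

section FaceWalk

variable {Dl : List Face} {w : Face} {σ : Side}

/-- Edge-adjacency of plaquettes (consecutive rhombi of a walk share the crossed edge). [cite: GlazmanManolescu2019, §1 (the walk crosses edges, passing to the rhombus on the other side)] -/
def Adj (f g : Face) : Prop := ∃ s : Side, g = nbr f s

/-- Edge-adjacency is symmetric. [folklore] -/
private theorem Adj.symm {f g : Face} (h : Adj f g) : Adj g f := by
  obtain ⟨s, rfl⟩ := h
  exact ⟨s.opp, (nbr_nbr_opp₄ f s).symm⟩

/-- Edge-connectivity inside a set of plaquettes. [cite: GlazmanManolescu2019, §1 (walks pass from rhombus to rhombus across edges)] -/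
def Conn (A : Set Face) : Face → Face → Prop :=
  Relation.ReflTransGen fun f g => Adj f g ∧ f ∈ A ∧ g ∈ A

/-- Edge-connectivity is symmetric. [folklore] -/
private theorem Conn.symm {A : Set Face} {f g : Face} (h : Conn A f g) : Conn A g f := by
  induction h with
  | refl => exact Relation.ReflTransGen.refl
  | tail _ hbc ih => exact Relation.ReflTransGen.head ⟨hbc.1.symm, hbc.2.2, hbc.2.1⟩ ih

/-- One edge step. [folklore] -/
private theorem Conn.tail' {A : Set Face} {f g g' : Face} (h : Conn A f g) (hg : g ∈ A) (hg' : g' ∈ A)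
    (ha : Adj g g') : Conn A f g' :=
  Relation.ReflTransGen.tail h ⟨ha, hg, hg'⟩

/-- What one step of the successor does to the right plaquette: keeps it (right turn), advances it across
an edge (straight), or advances it across an edge to the corner plaquette and across another edge to the
front-left plaquette (left turn). [folklore] -/
private theorem rtIn_nextRaw_cases (H : Set Face) (u : ℤ × ℤ) (d : Side) :
    let e' := nextRaw H (u, d)
    (rtIn e'.1 e'.2 = rtIn u d ∧ e'.2 = cw d ∧ rtOut u d ∈ H) ∨
      (rtIn e'.1 e'.2 = rtOut u d ∧ e'.2 = d ∧ rtOut u d ∉ H ∧ lfOut u d ∈ H) ∨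
      (rtIn e'.1 e'.2 = lfOut u d ∧ e'.2 = ccw d ∧ rtOut u d ∉ H ∧ lfOut u d ∉ H) := by
  intro e'
  have he' : e' = (u + step (turn H u d), turn H u d) := rfl
  rcases turn_cases (H := H) u d with ⟨e, h1⟩ | ⟨e, h1, h2⟩ | ⟨e, h1, h2⟩
  · refine Or.inl ⟨?_, by rw [he', e], h1⟩
    rw [he', e]; dsimp only; rw [rtIn_add_step, rtOut_cw]
  · refine Or.inr (Or.inl ⟨?_, by rw [he', e], h1, h2⟩)
    rw [he', e]; dsimp only; rw [rtIn_add_step]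
  · refine Or.inr (Or.inr ⟨?_, by rw [he', e], h1, h2⟩)
    rw [he', e]; dsimp only; rw [rtIn_add_step, rtOut_ccw]

/-- The right plaquette of the `k`-th dart of the orbit. [folklore] -/
def orbitFace (Dl : List Face) (w : Face) (σ : Side) (k : ℕ) : Face :=
  rtIn (orbit Dl w σ k).1 (orbit Dl w σ k).2

/-- **The right plaquettes of the orbit are edge-connected to the first lateral neighbour inside
`D ∖ {w}`, up to (but excluding) the return to the root dart, and the return closes the chain at the
OTHER lateral neighbour.** [folklore] -/
private theorem conn_laterals_cw (hw : w ∈ Dl) (hh : nbr w σ ∉ dom Dl) (hO : OuterRoot (dom Dl) (w.side σ.opp))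
    (hn : ¬OuterRoot (dom Dl) (w.side σ)) :
    Conn (dom (eraseFace Dl w)) (nbr w (cw σ)) (nbr w (cw σ).opp) := by
  classical
  -- the minimal period
  have hper := exists_period (σ := σ) hw hh
  let N := Nat.find hper
  have hN : 0 < N ∧ orbit Dl w σ N = orbit Dl w σ 0 := Nat.find_spec hper
  have hmin : ∀ k, 0 < k → k < N → orbit Dl w σ k ≠ orbit Dl w σ 0 := fun k hk hkN e =>
    Nat.find_min hper hkN ⟨hk, e⟩
  have hN2 : 2 ≤ N := by
    by_contra hlt
    have hN1 : N = 1 := by omega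
    have e := hN.2
    rw [hN1, orbit_succ] at e
    exact nextRaw_ne_self _ _ e
  -- abbreviations
  set A : Set Face := dom (eraseFace Dl w) with hA
  have memA : ∀ {f : Face}, f ∈ A ↔ f ∈ Dl ∧ f ≠ w := fun {f} => mem_eraseFace₄
  set p : Face := nbr w (cw σ) with hp
  have hB := inB_orbit (σ := σ) hw hh
  -- the right plaquettes of the orbit other than the root's are in `A`
  have hRA : ∀ k, 0 < k → k < N → orbitFace Dl w σ k ∈ A := by
    intro k hk hkN
    refine memA.2 ⟨rtIn_mem_dom (hB k), fun e => hmin k hk hkN ?_⟩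
    rw [orbit_zero]
    exact eq_root_of_rtIn_eq hw hh hO hn (hB k) e
  have hpA : p ∈ A := memA.2 ⟨lateral_mem_dom hw hh hO hn (cw_ne σ).1 (cw_ne σ).2, nbr_ne_self₄ w _⟩
  have hp'A : nbr w (cw σ).opp ∈ A :=
    memA.2 ⟨lateral_mem_dom hw hh hO hn (cw_opp_ne σ).1 (cw_opp_ne σ).2, nbr_ne_self₄ w _⟩
  -- induction along the orbit
  have main : ∀ k, 1 ≤ k → k < N → Conn A p (orbitFace Dl w σ k) := by
    intro k hk hkN
    induction k with
    | zero => omega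
    | succ k ih =>
      rcases Nat.eq_zero_or_pos k with rfl | hkpos
      · -- base: the first step from the root dart
        have hcase := rtIn_nextRaw_cases (hole Dl w σ) (rootHead w σ) (cw σ)
        simp only [] at hcase
        have e1 : orbit Dl w σ 1 = nextRaw (hole Dl w σ) (rootHead w σ, cw σ) := rfl
        unfold orbitFace
        rw [zero_add, e1]
        rcases hcase with ⟨hR, -, h1⟩ | ⟨hR, -, -, -⟩ | ⟨hR, -, -, h2⟩
        · exact absurd (rtOut_rootHead w σ ▸ h1) (lateral_not_mem_hole hw hh hO hn (cw_ne σ).1 (cw_ne σ).2)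
        · rw [hR, rtOut_rootHead]; exact Relation.ReflTransGen.refl
        · rw [hR]
          have hR1A : lfOut (rootHead w σ) (cw σ) ∈ A := by
            have := hRA 1 one_pos (by omega)
            unfold orbitFace at this; rwa [e1, hR] at this
          exact Conn.tail' Relation.ReflTransGen.refl hpA hR1A ⟨ccw (cw σ), by rw [lfOut_eq_nbr_rtOut, rtOut_rootHead]⟩
      · -- step
        have ihk := ih hkpos (by omega)
        have hcase := rtIn_nextRaw_cases (hole Dl w σ) (orbit Dl w σ k).1 (orbit Dl w σ k).2
        simp only [Prod.mk.eta] at hcase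
        have hBk : InB (hole Dl w σ) ((orbit Dl w σ k).1, (orbit Dl w σ k).2) := by
          simpa only [Prod.mk.eta] using hB k
        have hk1A := hRA (k + 1) (by omega) hkN
        unfold orbitFace at hk1A ⊢
        rw [orbit_succ]
        rw [orbit_succ] at hk1A
        rcases hcase with ⟨hR, -, -⟩ | ⟨hR, -, h1, -⟩ | ⟨hR, -, h1, h2⟩
        · rw [hR]; exact ihk
        · rw [hR] at hk1A ⊢
          exact Conn.tail' ihk (hRA k hkpos (by omega)) hk1A ⟨_, rtOut_eq_nbr_rtIn _ _⟩
        · rw [hR] at hk1A ⊢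
          have hcA : rtOut (orbit Dl w σ k).1 (orbit Dl w σ k).2 ∈ A :=
            memA.2 ⟨rtOut_mem_dom hBk h1, rtOut_ne_self hw hh hO hn hBk h1 h2⟩
          exact Conn.tail' (Conn.tail' ihk (hRA k hkpos (by omega)) hcA ⟨_, rtOut_eq_nbr_rtIn _ _⟩) hcA hk1A
            ⟨_, lfOut_eq_nbr_rtOut _ _⟩
  -- the return to the root dart
  have hlast := main (N - 1) (by omega) (by omega)
  have hRA' := hRA (N - 1) (by omega) (by omega)
  have hBk := hB (N - 1)
  have eN : nextRaw (hole Dl w σ) (orbit Dl w σ (N - 1)) = (rootHead w σ, cw σ) := by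
    rw [← orbit_succ, show N - 1 + 1 = N from by omega, hN.2, orbit_zero]
  unfold orbitFace at hlast hRA'
  set u : ℤ × ℤ := (orbit Dl w σ (N - 1)).1 with hu
  set d : Side := (orbit Dl w σ (N - 1)).2 with hd0
  have eud : orbit Dl w σ (N - 1) = (u, d) := by rw [hu, hd0]
  rw [eud] at hBk eN
  clear_value u d
  have hRne : rtIn u d ≠ w := (memA.1 hRA').2
  have hcase := rtIn_nextRaw_cases (hole Dl w σ) u d
  rw [eN] at hcase
  simp only [rtIn_rootHead] at hcase
  rcases hcase with ⟨hR, -, -⟩ | ⟨hR, hd, -, -⟩ | ⟨hR, hd, h1, -⟩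
  · exact absurd hR.symm hRne
  · -- straight: the last right plaquette is the other lateral neighbour
    subst hd
    have e : nbr w (cw σ).opp = rtIn u (cw σ) := by rw [hR, rtOut_eq_nbr_rtIn, nbr_nbr_opp₄]
    rw [e]; exact hlast
  · -- left: the corner plaquette is the other lateral neighbour
    have hd' : d = cw (cw σ) := by rw [← cw_ccw d, ← hd]
    subst hd'
    have e : nbr w (cw σ).opp = rtOut u (cw (cw σ)) := by rw [hR, lfOut_eq_nbr_rtOut, ccw_cw, nbr_nbr_opp₄]
    refine Conn.tail' hlast hRA' hp'A ?_
    rw [e]; exact ⟨_, rtOut_eq_nbr_rtIn _ _⟩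

/-- **The two lateral neighbours of `w` are edge-connected inside `D ∖ {w}`** when the root behind the
missing plaquette is not an outer root (the digital-topology content of «Ω simply connected» in the printed
lemma: the king-exterior boundary of a king-connected hole is edge-connected). [cite: DuminilCopinSmirnov2012, proof of Lemma 1 («we used the fact that a is on the boundary and Ω is simply connected»)] [cite: FriedliVelenik2017, App. B.15 (boundary connectivity of ★-connected subsets of ℤ^d)] -/
theorem conn_laterals (hw : w ∈ Dl) (hh : nbr w σ ∉ dom Dl) (hO : OuterRoot (dom Dl) (w.side σ.opp))
    (hn : ¬OuterRoot (dom Dl) (w.side σ)) :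
    Conn (dom (eraseFace Dl w)) (nbr w (lat σ)) (nbr w (lat σ).opp) := by
  have h := conn_laterals_cw hw hh hO hn
  rcases cw_lateral σ with ⟨e1, -⟩ | ⟨e1, -⟩
  · rwa [e1] at h
  · rw [e1, Side.opp_opp₄] at h; exact h.symm

end FaceWalk

/-! ### From edge-connectivity to a shortest chain of plaquettes, and the walk it carries -/

section Chain

variable {Dl : List Face} {w : Face} {σ : Side}

/-- An edge-connected pair is joined by a chain of edge-adjacent plaquettes of the set. [folklore] -/
private theorem exists_chain_of_conn {A : Set Face} {a b : Face} (h : Conn A a b) (ha : a ∈ A) :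
    ∃ (n : ℕ) (g : ℕ → Face), g 0 = a ∧ g n = b ∧ (∀ i ≤ n, g i ∈ A) ∧ ∀ i < n, Adj (g i) (g (i + 1)) := by
  induction h with
  | refl => exact ⟨0, fun _ => a, rfl, rfl, fun _ _ => ha, fun _ hi => absurd hi (Nat.not_lt_zero _)⟩
  | @tail b c _ hbc ih =>
    obtain ⟨n, g, h0, hn, hA, hadj⟩ := ih
    refine ⟨n + 1, fun i => if i ≤ n then g i else c, by simp [h0], by simp, ?_, ?_⟩
    · intro i hi
      dsimp only
      by_cases hi' : i ≤ n
      · rw [if_pos hi']; exact hA i hi'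
      · rw [if_neg hi']; exact hbc.2.2
    · intro i hi
      dsimp only
      by_cases hi' : i < n
      · rw [if_pos hi'.le, if_pos (by omega)]; exact hadj i hi'
      · have : i = n := by omega
        subst this
        rw [if_pos le_rfl, if_neg (by omega), hn]; exact hbc.1

/-- A SHORTEST chain has pairwise distinct plaquettes. [folklore] -/
private theorem exists_min_chain {A : Set Face} {a b : Face} (h : Conn A a b) (ha : a ∈ A) :
    ∃ (n : ℕ) (g : ℕ → Face), g 0 = a ∧ g n = b ∧ (∀ i ≤ n, g i ∈ A) ∧ (∀ i < n, Adj (g i) (g (i + 1))) ∧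
      ∀ i j, i ≤ n → j ≤ n → g i = g j → i = j := by
  classical
  let P : ℕ → Prop := fun n => ∃ g : ℕ → Face, g 0 = a ∧ g n = b ∧ (∀ i ≤ n, g i ∈ A) ∧ ∀ i < n, Adj (g i) (g (i + 1))
  have hP : ∃ n, P n := by
    obtain ⟨n, g, h0, hn, hA, hadj⟩ := exists_chain_of_conn h ha
    exact ⟨n, g, h0, hn, hA, hadj⟩
  let n := Nat.find hP
  obtain ⟨g, h0, hn, hA, hadj⟩ : P n := Nat.find_spec hP
  refine ⟨n, g, h0, hn, hA, hadj, ?_⟩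
  -- if two plaquettes coincide, splice the chain
  have key : ∀ i j, i < j → j ≤ n → g i = g j → False := by
    intro i j hij hj e
    have hshort : P (n - (j - i)) := by
      refine ⟨fun k => if k ≤ i then g k else g (k + (j - i)), by dsimp only; rw [if_pos (Nat.zero_le _), h0],
        ?_, ?_, ?_⟩
      · dsimp only
        by_cases hc : n - (j - i) ≤ i
        · rw [if_pos hc]
          have : j = n := by omega
          subst this
          rw [show n - (n - i) = i from by omega, e, hn]
        · rw [if_neg hc, show n - (j - i) + (j - i) = n from by omega, hn]
      · intro k hk
        dsimp only
        by_cases hc : k ≤ i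
        · rw [if_pos hc]; exact hA k (by omega)
        · rw [if_neg hc]; exact hA _ (by omega)
      · intro k hk
        dsimp only
        by_cases hc : k + 1 ≤ i
        · rw [if_pos (by omega), if_pos hc]; exact hadj k (by omega)
        · by_cases hc' : k ≤ i
          · have hki : k = i := by omega
            subst hki
            rw [if_pos le_rfl, if_neg (by omega), e, show k + 1 + (j - k) = j + 1 from by omega]
            exact hadj j (by omega)
          · rw [if_neg hc', if_neg hc, show k + 1 + (j - i) = k + (j - i) + 1 from by omega]
            exact hadj _ (by omega)
    have := Nat.find_min hP (show n - (j - i) < n by omega)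
    exact this hshort
  intro i j hi hj e
  rcases lt_trichotomy i j with hij | hij | hij
  · exact (key i j hij hj e).elim
  · exact hij
  · exact (key j i hij hi e.symm).elim

/-- The data of a slot chain: a shortest chain of pairwise distinct plaquettes of `D ∖ {w}` from
`nbr w ℓ` to `nbr w ℓ.opp`, `ℓ = lat σ`. [folklore] -/
private theorem exists_slot_chain (hw : w ∈ Dl) (hh : nbr w σ ∉ dom Dl) (hO : OuterRoot (dom Dl) (w.side σ.opp))
    (hn : ¬OuterRoot (dom Dl) (w.side σ)) :
    ∃ (n : ℕ) (g : ℕ → Face), g 0 = nbr w (lat σ) ∧ g n = nbr w (lat σ).opp ∧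
      (∀ i ≤ n, g i ∈ dom (eraseFace Dl w)) ∧ (∀ i < n, Adj (g i) (g (i + 1))) ∧
      ∀ i j, i ≤ n → j ≤ n → g i = g j → i = j :=
  exists_min_chain (conn_laterals hw hh hO hn)
    (mem_eraseFace₄.2 ⟨lateral_mem_dom hw hh hO hn (lat_facts₄ σ).1 (lat_facts₄ σ).2.1, nbr_ne_self₄ w _⟩)

end Chain

/-! ### The slot-crossing walk -/

section Walk

variable {Dl : List Face} {w : Face} {σ : Side}

/-- Number of arcs of a mid-edge list. [folklore] -/
private theorem arcsOf_length (l : List MidEdge) : (arcsOf l).length = l.length - 1 := by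
  simp [arcsOf, List.length_zip]

/-- The arcs of a mid-edge list by index. [folklore] -/
private theorem arcsOf_getElem (l : List MidEdge) {k : ℕ} (hk : k < (arcsOf l).length) :
    (arcsOf l)[k] = (l[k]'(by rw [arcsOf_length] at hk; omega), l[k + 1]'(by rw [arcsOf_length] at hk; omega)) := by
  simp [arcsOf, List.getElem_zip, List.getElem_tail]

/-- Plaquette sequence of the walk: `w`, the chain `g 0, …, g n`, then `w` again. [folklore] -/
def chainFace (w : Face) (n : ℕ) (g : ℕ → Face) (i : ℕ) : Face :=
  if i = 0 then w else if i ≤ n + 1 then g (i - 1) else w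

/-- Exit side of the `i`-th plaquette of the sequence towards the next one. [folklore] -/
def chainSide (σ : Side) (n : ℕ) (sd : ℕ → Side) (i : ℕ) : Side :=
  if i = 0 then lat σ else if i ≤ n then sd (i - 1) else lat σ

/-- The mid-edges of the walk: the exit side of each plaquette of the sequence. [folklore] -/
def chainMid (w : Face) (σ : Side) (n : ℕ) (g : ℕ → Face) (sd : ℕ → Side) (i : ℕ) : MidEdge :=
  (chainFace w n g i).side (chainSide σ n sd i)

/-- **The slot-crossing walk exists at every genuine isthmus hole root**: for every finite face list `Dl`,
every `w ∈ Dl` and side `σ` with the plaquette across `σ` missing, the opposite side `w.side σ.opp` an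
outer root and the root `w.side σ` itself NOT an outer root (the missing plaquette lies in a hole of `D`,
of arbitrary shape), some self-avoiding plaquette walk of `D ∖ {w}` joins the two lateral sides of `w`.
[cite: DuminilCopinSmirnov2012, proof of Lemma 1 («we used the fact that a is on the boundary and Ω is simply connected»)] [cite: GlazmanManolescu2019, Lemma 2.1] -/
theorem nonempty_slot_of_not_outerRoot (Dl : List Face) (w : Face) (σ : Side) (hw : w ∈ Dl)
    (hh : nbr w σ ∉ dom Dl) (hO : OuterRoot (dom Dl) (w.side σ.opp)) (hn : ¬OuterRoot (dom Dl) (w.side σ)) :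
    ∃ δ : YBWalk (dom (eraseFace Dl w)) (w.side (lat σ)) (w.side (lat σ).opp),
      (arcsOf δ.mids).Pairwise fun p q => arcFace p ≠ arcFace q := by
  classical
  obtain ⟨n, g, h0, hlast, hA, hadj, hinj⟩ := exists_slot_chain hw hh hO hn
  set ℓ := lat σ with hℓ
  -- `n ≥ 1`: the two lateral neighbours differ
  have hn1 : 1 ≤ n := by
    rcases Nat.eq_zero_or_pos n with hz | hz
    · subst hz
      exact absurd (nbr_side_inj (h0.symm.trans hlast)) (Side.opp_ne_self₄ ℓ).symm
    · exact hz
  -- directions along the chain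
  have hsd0 : ∀ i, ∃ s : Side, i < n → g (i + 1) = nbr (g i) s := by
    intro i
    by_cases hi : i < n
    · obtain ⟨s, hs⟩ := hadj i hi; exact ⟨s, fun _ => hs⟩
    · exact ⟨ℓ, fun h => absurd h hi⟩
  choose sd hsd using hsd0
  -- abbreviations
  set F : ℕ → Face := chainFace w n g with hF
  set t : ℕ → Side := chainSide σ n sd with ht
  set v : ℕ → MidEdge := chainMid w σ n g sd with hv
  have hF0 : F 0 = w := by simp [hF, chainFace]
  have hFsucc : ∀ i ≤ n, F (i + 1) = g i := fun i hi => by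
    simp [hF, chainFace, show i + 1 ≤ n + 1 from by omega]
  have hFlast : F (n + 2) = w := by simp [hF, chainFace]
  have ht0 : t 0 = ℓ := by simp [ht, chainSide, hℓ]
  have htmid : ∀ i, 1 ≤ i → i ≤ n → t i = sd (i - 1) := fun i h1 h2 => by
    simp [ht, chainSide, show i ≠ 0 from by omega, h2]
  have htlast : t (n + 1) = ℓ := by simp [ht, chainSide, hℓ]
  have hv_def : ∀ i, v i = (F i).side (t i) := fun i => rfl
  -- consecutive plaquettes
  have hstep : ∀ i ≤ n + 1, F (i + 1) = nbr (F i) (t i) := by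
    intro i hi
    rcases Nat.eq_zero_or_pos i with rfl | hpos
    · rw [zero_add, hFsucc 0 (by omega), hF0, ht0, h0]
    · rcases Nat.lt_or_ge i (n + 1) with hlt | hge
      · rw [hFsucc i (by omega), show i = (i - 1) + 1 from by omega, hFsucc (i - 1) (by omega),
          show i - 1 + 1 = i from by omega, htmid i hpos (by omega)]
        have e := hsd (i - 1) (by omega)
        rwa [show i - 1 + 1 = i from by omega] at e
      · have hi' : i = n + 1 := by omega
        subst hi'
        rw [hFlast, hFsucc n le_rfl, htlast, hlast]
        have e := nbr_nbr_opp₄ w ℓ.opp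
        rw [Side.opp_opp₄] at e
        exact e.symm
  -- membership and injectivity on `[1, n+1]`, `F 0 = w`
  have hFA : ∀ i, 1 ≤ i → i ≤ n + 1 → F i ∈ dom (eraseFace Dl w) := by
    intro i h1 h2
    rw [show i = (i - 1) + 1 from by omega, hFsucc (i - 1) (by omega)]
    exact hA (i - 1) (by omega)
  have hFne : ∀ i, 1 ≤ i → i ≤ n + 1 → F i ≠ w := fun i h1 h2 => (mem_eraseFace₄.1 (hFA i h1 h2)).2
  have hFinj : ∀ i j, i ≤ n + 1 → j ≤ n + 1 → F i = F j → i = j := by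
    intro i j hi hj e
    rcases Nat.eq_zero_or_pos i with rfl | hip <;> rcases Nat.eq_zero_or_pos j with rfl | hjp
    · rfl
    · exact absurd (hF0.symm.trans e).symm (hFne j hjp hj)
    · exact absurd (e.trans hF0) (hFne i hip hi)
    · rw [show i = (i - 1) + 1 from by omega, hFsucc (i - 1) (by omega),
        show j = (j - 1) + 1 from by omega, hFsucc (j - 1) (by omega)] at e
      have := hinj (i - 1) (j - 1) (by omega) (by omega) e
      omega
  -- `F (i+2) ≠ F i` (no immediate return), including the wrap-around at the end
  have hFskip : ∀ i ≤ n, F (i + 2) ≠ F i := by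
    intro i hi e
    rcases Nat.lt_or_ge (i + 2) (n + 2) with hlt | hge
    · exact absurd (hFinj _ _ (by omega) (by omega) e) (by omega)
    · have hi' : i = n := by omega
      subst hi'
      rw [hFlast] at e
      exact hFne i hn1 (by omega) e.symm
  -- entry and exit sides differ
  have htne : ∀ i ≤ n, (t i).opp ≠ t (i + 1) := by
    intro i hi e
    apply hFskip i hi
    rw [show i + 2 = (i + 1) + 1 from rfl, hstep (i + 1) (by omega), ← e, hstep i (by omega), nbr_nbr_opp₄]
  -- the entry side of plaquette `i+1` is the exit side of plaquette `i`
  have hv_entry : ∀ i ≤ n + 1, v i = (F (i + 1)).side (t i).opp := by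
    intro i hi
    rw [hv_def, hstep i hi, side_nbr_opp₄]
  -- the arcs
  have harc : ∀ i ≤ n, arcFace (v i, v (i + 1)) = some (F (i + 1)) := by
    intro i hi
    rw [hv_entry i (by omega), hv_def]
    exact arcFace_side_side _ _ _ (htne i hi)
  -- injectivity of the mid-edges
  have hvinj : ∀ i j, i ≤ n + 1 → j ≤ n + 1 → v i = v j → i = j := by
    have aux : ∀ i j, i ≤ n + 1 → j ≤ n + 1 → v i = v j → (F j = F i ∨ F j = F (i + 1)) := by
      intro i j hi hj e
      rw [hv_def, hv_def] at e
      rcases eq_or_eq_nbr_of_side_eq₄ e.symm with h | h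
      · exact Or.inl h
      · exact Or.inr (by rw [h, hstep i hi])
    intro i j hi hj e
    rcases aux i j hi hj e with h1 | h1 <;> rcases aux j i hj hi e.symm with h2 | h2
    · exact (hFinj i j hi hj h1.symm)
    · exact (hFinj i j hi hj h1.symm)
    · exact (hFinj i j hi hj h2)
    · -- `F j = F (i+1)` and `F i = F (j+1)`
      exfalso
      rcases Nat.lt_or_ge (i + 1) (n + 2) with hi2 | hi2
      · have hj' : j = i + 1 := hFinj j (i + 1) hj (by omega) h1
        subst hj'
        exact hFskip i (by omega) h2.symm
      · have hi' : i = n + 1 := by omega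
        subst hi'
        rw [hFlast, ← hF0] at h1
        have hj0 : j = 0 := hFinj j 0 hj (by omega) h1
        subst hj0
        rw [zero_add] at h2
        have := hFinj (n + 1) 1 le_rfl (by omega) h2
        omega
  -- the walk
  let δ₀ : YBWalk (dom (eraseFace Dl w)) (v 0) (v (n + 1)) :=
    YBWalk.ofFn (D := dom (eraseFace Dl w)) (n + 1) v hvinj
      (fun i hi => ⟨F (i + 1), hFA (i + 1) (by omega) (by omega), harc i (by omega)⟩)
      (by
        intro i hi e
        rw [harc i (by omega), harc (i + 1) (by omega)] at e
        have := hFinj (i + 1) (i + 2) (by omega) (by omega) (Option.some_injective _ e)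
        omega)
      (by
        intro i j hi hj f hWE hSN
        -- no two crossing straight arcs: each plaquette carries one arc
        have hfi : f = F (i + 1) := by
          have h1 : arcFace (v i, v (i + 1)) = some f := by
            rcases hWE with h | h <;> rw [h] <;> exact arcFace_side_side f _ _ (by decide)
          rw [harc i (by omega)] at h1
          exact (Option.some_injective _ h1).symm
        have hfj : f = F (j + 1) := by
          have h1 : arcFace (v j, v (j + 1)) = some f := by
            rcases hSN with h | h <;> rw [h] <;> exact arcFace_side_side f _ _ (by decide)
          rw [harc j (by omega)] at h1
          exact (Option.some_injective _ h1).symm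
        have hij : i = j := by
          have := hFinj (i + 1) (j + 1) (by omega) (by omega) (hfi.symm.trans hfj); omega
        subst hij
        rcases hWE with h | h <;> rcases hSN with h' | h' <;>
          exact absurd ((Face.side_injective f (Prod.mk.inj (h.symm.trans h')).1)) (by decide))
  have hstart : v 0 = w.side ℓ := by rw [hv_def, hF0, ht0]
  have hend : v (n + 1) = w.side ℓ.opp := by
    have e := side_nbr_opp₄ w ℓ.opp
    rw [Side.opp_opp₄] at e
    rw [hv_def, hFsucc n le_rfl, htlast, hlast]
    exact e
  refine ⟨δ₀.cast hstart hend, ?_⟩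
  -- one arc per plaquette
  rw [YBWalk.cast_mids, YBWalk.ofFn_mids, List.pairwise_iff_getElem]
  intro i j hi hj hij
  rw [arcsOf_length, List.length_ofFn] at hi hj
  rw [arcsOf_getElem, arcsOf_getElem]
  simp only [List.getElem_ofFn]
  rw [harc i (by omega), harc j (by omega)]
  intro e
  have := hFinj (i + 1) (j + 1) (by omega) (by omega) (Option.some_injective _ e)
  omega

end Walk

/-! ### Positivity of the slot weight sum on the CLOSED printed range -/

section Positivity

variable {Dl : List Face} {w : Face} {σ : Side}

/-- A `filterMap` selecting by a key that occurs at most once has length at most one. [folklore] -/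
private theorem length_filterMap_ite_le_one {α β γ : Type*} [DecidableEq γ] (φ : α → γ) (ψ : α → Option β)
    (c : γ) : ∀ (L : List α), L.Pairwise (fun a b => φ a ≠ φ b) →
      (L.filterMap fun a => if φ a = c then ψ a else none).length ≤ 1
  | [], _ => by simp
  | a :: L, h => by
    rw [List.pairwise_cons] at h
    by_cases ha : φ a = c
    · have hrest : (L.filterMap fun b => if φ b = c then ψ b else none) = [] := by
        rw [List.filterMap_eq_nil_iff]
        intro b hb
        rw [if_neg (fun hbc => h.1 b hb (ha.trans hbc.symm))]
      cases hψ : ψ a with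
      | none =>
        rw [List.filterMap_cons_none (by simp only [ha, if_true, hψ]), hrest]; simp
      | some k =>
        rw [List.filterMap_cons_some (b := k) (by simp only [ha, if_true, hψ]), hrest]; simp
    · rw [List.filterMap_cons_none (by simp only [ha, if_false])]
      exact length_filterMap_ite_le_one φ ψ c L h.2

/-- **One arc per plaquette ⇒ no two-arc configuration**: if the arcs of a mid-edge list lie in pairwise
distinct plaquettes, no plaquette carries a two-arc configuration. [cite: GlazmanManolescu2019, §1, Fig. 1 (the two-arc configurations w₁, w₂)] -/
theorem cfgCount_pair_eq_zero (l : List MidEdge) (hl : (arcsOf l).Pairwise fun p q => arcFace p ≠ arcFace q)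
    (κ κ' : ArcKind) : cfgCount l [κ, κ'] = 0 := by
  unfold cfgCount
  rw [List.countP_eq_zero]
  intro f _ h
  simp only [decide_eq_true_eq] at h
  have hlen : (kindsL l f).length ≤ 1 :=
    length_filterMap_ite_le_one arcFace arcKindOf (some f) (arcsOf l) hl
  rw [h] at hlen
  simp at hlen

/-- **A walk with one arc per plaquette has positive printed weight on the whole closed range**
`[π/3, 2π/3]` (only `u₁, u₂, v > 0` enter). [cite: GlazmanManolescu2019, eq. (1), §1 Fig. 2 (u₁, u₂, v > 0 on [π/3, 2π/3]; w₂(π/3) = 0)] -/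
theorem realWeightL_pos_of_pairwise {θ : ℝ} (hθ : θ ∈ Set.Icc (π / 3) (2 * π / 3)) (l : List MidEdge)
    (hl : (arcsOf l).Pairwise fun p q => arcFace p ≠ arcFace q) : 0 < realWeightL θ l := by
  unfold realWeightL
  rw [cfgCount_pair_eq_zero l hl, cfgCount_pair_eq_zero l hl, pow_zero, pow_zero, mul_one, mul_one]
  have h1 := weightU1_pos hθ
  have h2 := weightU2_pos hθ
  have h3 := weightV_pos_of_mem hθ
  positivity

/-- ★★ **The slot weight sum is POSITIVE at every genuine isthmus hole root, for every `θ` of the closed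
printed range** (including the hexagonal point `θ = π/3`): `B_θ(D, w, σ) > 0` whenever the plaquette
across `σ` is missing, `w.side σ.opp` is an outer root and `w.side σ` is not.
[cite: DuminilCopinSmirnov2012, proof of Lemma 1 («we used the fact that a is on the boundary and Ω is simply connected»)] [cite: GlazmanManolescu2019, Lemma 2.1, eq. (1)] -/
theorem slotWeightSum_pos_of_not_outerRoot {θ : ℝ} (hθ : θ ∈ Set.Icc (π / 3) (2 * π / 3)) (Dl : List Face)
    (w : Face) (σ : Side) (hw : w ∈ Dl) (hh : nbr w σ ∉ dom Dl) (hO : OuterRoot (dom Dl) (w.side σ.opp))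
    (hn : ¬OuterRoot (dom Dl) (w.side σ)) : 0 < slotWeightSum θ Dl w σ := by
  obtain ⟨δ, hδ⟩ := nonempty_slot_of_not_outerRoot Dl w σ hw hh hO hn
  unfold slotWeightSum
  have hle : realWeightL θ δ.mids ≤
      ∑ δ' : YBWalk (dom (eraseFace Dl w)) (w.side (lat σ)) (w.side (lat σ).opp), realWeightL θ δ'.mids :=
    Finset.single_le_sum (fun δ' _ => realWeightL_nonneg hθ δ'.mids) (Finset.mem_univ δ)
  exact lt_of_lt_of_le (realWeightL_pos_of_pairwise hθ δ.mids hδ) hle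

/-- `B_θ > 0` iff the root is not outer (the converse through C-B2 and the hole defect law). [cite: GlazmanManolescu2019, Lemma 2.1] [cite: DuminilCopinSmirnov2012, Lemma 1] -/
theorem slotWeightSum_pos_iff_not_outerRoot {θ : ℝ} (hθ : θ ∈ Set.Icc (π / 3) (2 * π / 3)) (Dl : List Face)
    (w : Face) (σ : Side) (hw : w ∈ Dl) (hh : nbr w σ ∉ dom Dl) (hO : OuterRoot (dom Dl) (w.side σ.opp)) :
    0 < slotWeightSum θ Dl w σ ↔ ¬OuterRoot (dom Dl) (w.side σ) := by
  constructor
  · intro hpos hO'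
    have h0 : slotWeightSum θ Dl w σ = 0 :=
      (vertexFunctional_printed_isthmus_root_eq_zero_iff_weightSum hθ Dl w σ hw hh hO).1
        (vertexFunctional_printed_eq_zero hθ Dl (w.side σ) hO' w hw)
    exact hpos.ne' h0
  · exact slotWeightSum_pos_of_not_outerRoot hθ Dl w σ hw hh hO

end Positivity

/-! ### The isthmus dichotomy -/

section Dichotomy

variable {Dl : List Face} {w : Face} {σ : Side}

/-- ★★★ **The Yang–Baxter vertex identity FAILS at the root plaquette of every genuine isthmus hole root**:
for every `θ ∈ [π/3, 2π/3]`, every finite face list `Dl`, every `w ∈ Dl` and side `σ` with the plaquette across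
`σ` missing, `w.side σ.opp` an outer root and `w.side σ` NOT an outer root (a hole of arbitrary shape behind
the root), `VF_D(w.side σ, w) ≠ 0`. [cite: DuminilCopinSmirnov2012, proof of Lemma 1 («we used the fact that a is on the boundary and Ω is simply connected»)] [cite: GlazmanManolescu2019, Lemma 2.1] -/
theorem vertexFunctional_printed_isthmus_root_ne_zero_of_not_outerRoot {θ : ℝ}
    (hθ : θ ∈ Set.Icc (π / 3) (2 * π / 3)) (Dl : List Face) (w : Face) (σ : Side) (hw : w ∈ Dl)
    (hh : nbr w σ ∉ dom Dl) (hO : OuterRoot (dom Dl) (w.side σ.opp)) (hn : ¬OuterRoot (dom Dl) (w.side σ)) :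
    vertexFunctional (printedWeights θ) tFiveEighths (ybCoeff θ) Dl (w.side σ) w ≠ 0 := by
  rw [Ne, vertexFunctional_printed_isthmus_root_eq_zero_iff_weightSum hθ Dl w σ hw hh hO]
  exact (slotWeightSum_pos_of_not_outerRoot hθ Dl w σ hw hh hO hn).ne'

/-- ★★★★ **THE ISTHMUS DICHOTOMY.** For every `θ ∈ [π/3, 2π/3]`, every finite face list `Dl`, every
plaquette `w ∈ Dl` and side `σ` with the plaquette across `σ` missing and the opposite side `w.side σ.opp`
an outer root (a width-one isthmus), the Yang–Baxter vertex identity of Glazman–Manolescu / Duminil-Copin–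
Smirnov at the root plaquette `w`, for the walks from the root `w.side σ`, HOLDS IF AND ONLY IF the root is an
OUTER root: the outer-boundary hypothesis of the printed lemma is sharp at every isthmus (`←`: the tree's
C-B2 `vertexFunctional_printed_eq_zero`; `→`: the hole defect law of Part 3 and the slot-crossing walk of
this file). [cite: DuminilCopinSmirnov2012, Lemma 1 and its proof («we used the fact that a is on the boundary and Ω is simply connected»)] [cite: GlazmanManolescu2019, Lemma 2.1] -/
theorem vertexFunctional_printed_isthmus_root_eq_zero_iff_outerRoot {θ : ℝ}
    (hθ : θ ∈ Set.Icc (π / 3) (2 * π / 3)) (Dl : List Face) (w : Face) (σ : Side) (hw : w ∈ Dl)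
    (hh : nbr w σ ∉ dom Dl) (hO : OuterRoot (dom Dl) (w.side σ.opp)) :
    vertexFunctional (printedWeights θ) tFiveEighths (ybCoeff θ) Dl (w.side σ) w = 0 ↔
      OuterRoot (dom Dl) (w.side σ) := by
  constructor
  · intro h
    by_contra hn
    exact vertexFunctional_printed_isthmus_root_ne_zero_of_not_outerRoot hθ Dl w σ hw hh hO hn h
  · intro hO'
    exact vertexFunctional_printed_eq_zero hθ Dl (w.side σ) hO' w hw

/-- ★★★★ **The full vertex identity from an isthmus root holds at EVERY plaquette iff the root is outer**
(Part 1 gives it at every plaquette other than `w` unconditionally). [cite: GlazmanManolescu2019, Lemma 2.1] [cite: DuminilCopinSmirnov2012, Lemma 1] -/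
theorem vertexFunctional_printed_isthmus_eq_zero_forall_iff_outerRoot {θ : ℝ}
    (hθ : θ ∈ Set.Icc (π / 3) (2 * π / 3)) (Dl : List Face) (w : Face) (σ : Side) (hw : w ∈ Dl)
    (hh : nbr w σ ∉ dom Dl) (hO : OuterRoot (dom Dl) (w.side σ.opp)) :
    (∀ f₀ ∈ Dl, vertexFunctional (printedWeights θ) tFiveEighths (ybCoeff θ) Dl (w.side σ) f₀ = 0) ↔
      OuterRoot (dom Dl) (w.side σ) := by
  constructor
  · intro h
    exact (vertexFunctional_printed_isthmus_root_eq_zero_iff_outerRoot hθ Dl w σ hw hh hO).1 (h w hw)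
  · intro hO' f₀ hf₀
    exact vertexFunctional_printed_eq_zero hθ Dl (w.side σ) hO' f₀ hf₀

/-- ★★★ **The modulus of the defect is positive exactly at genuine hole roots**:
`‖VF_D(w.side σ, w)‖ = 2·v(θ)·B_θ(D,w,σ) > 0 ↔ ¬OuterRoot (w.side σ)`. [cite: GlazmanManolescu2019, Lemma 2.1, eq. (1)] [cite: DuminilCopinSmirnov2012, Lemma 1] -/
theorem norm_vertexFunctional_printed_isthmus_root_pos_iff {θ : ℝ} (hθ : θ ∈ Set.Icc (π / 3) (2 * π / 3))
    (Dl : List Face) (w : Face) (σ : Side) (hw : w ∈ Dl) (hh : nbr w σ ∉ dom Dl)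
    (hO : OuterRoot (dom Dl) (w.side σ.opp)) :
    0 < ‖vertexFunctional (printedWeights θ) tFiveEighths (ybCoeff θ) Dl (w.side σ) w‖ ↔
      ¬OuterRoot (dom Dl) (w.side σ) := by
  rw [norm_pos_iff, Ne, vertexFunctional_printed_isthmus_root_eq_zero_iff_outerRoot hθ Dl w σ hw hh hO]

/-- ★★★ **The hexagonal point** `θ = π/3` (Duminil-Copin–Smirnov's lattice, `x_c = 1/√(2+√2)`): at a
width-one isthmus the identity at the root plaquette holds iff the root is outer (and at a genuine hole root
`‖VF‖ = (2 − √2)·B_{π/3}(D,w,σ) > 0`, Part 3b). [cite: DuminilCopinSmirnov2012, Lemma 1 and its proof; §1 (x_c)] [cite: GlazmanManolescu2019, §1 Fig. 2 (θ = π/3), Lemma 2.1] -/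
theorem vertexFunctional_hex_isthmus_root_eq_zero_iff_outerRoot (Dl : List Face) (w : Face) (σ : Side)
    (hw : w ∈ Dl) (hh : nbr w σ ∉ dom Dl) (hO : OuterRoot (dom Dl) (w.side σ.opp)) :
    vertexFunctional (printedWeights (π / 3)) tFiveEighths (ybCoeff (π / 3)) Dl (w.side σ) w = 0 ↔
      OuterRoot (dom Dl) (w.side σ) :=
  vertexFunctional_printed_isthmus_root_eq_zero_iff_outerRoot pi_div_three_mem_Icc Dl w σ hw hh hO

/-- ★★★ **Combinatorial form (θ-free): at a width-one isthmus, NO self-avoiding plaquette walk of `D ∖ {w}`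
joins the two lateral sides of `w` iff the root `w.side σ` is an outer root** — a separation statement of
digital topology; `←` is Part 3b's pinch corollary (proved through the observable at `θ = π/2`), `→` is the
boundary tracing of this file. [cite: DuminilCopinSmirnov2012, Lemma 1 (a ∈ ∂Ω, Ω simply connected)] -/
theorem isEmpty_slot_iff_outerRoot (Dl : List Face) (w : Face) (σ : Side) (hw : w ∈ Dl)
    (hh : nbr w σ ∉ dom Dl) (hO : OuterRoot (dom Dl) (w.side σ.opp)) :
    IsEmpty (YBWalk (dom (eraseFace Dl w)) (w.side (lat σ)) (w.side (lat σ).opp)) ↔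
      OuterRoot (dom Dl) (w.side σ) := by
  constructor
  · intro h
    by_contra hn
    obtain ⟨δ, -⟩ := nonempty_slot_of_not_outerRoot Dl w σ hw hh hO hn
    exact h.false δ
  · exact isEmpty_slot_of_outerRoot_both Dl w σ hw hh hO

/-- ★★★ **Closed-range form of Part 3h's criterion**: for every `θ ∈ [π/3, 2π/3]` (the open-range
restriction of `vertexFunctional_printed_isthmus_root_ne_zero_iff_nonempty` is gone), the identity FAILS at the
root plaquette of an isthmus iff SOME walk of `D ∖ {w}` crosses the slot. [cite: DuminilCopinSmirnov2012, proof of Lemma 1] [cite: GlazmanManolescu2019, Lemma 2.1] -/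
theorem vertexFunctional_printed_isthmus_root_ne_zero_iff_nonempty_of_mem_Icc {θ : ℝ}
    (hθ : θ ∈ Set.Icc (π / 3) (2 * π / 3)) (Dl : List Face) (w : Face) (σ : Side) (hw : w ∈ Dl)
    (hh : nbr w σ ∉ dom Dl) (hO : OuterRoot (dom Dl) (w.side σ.opp)) :
    vertexFunctional (printedWeights θ) tFiveEighths (ybCoeff θ) Dl (w.side σ) w ≠ 0 ↔
      Nonempty (YBWalk (dom (eraseFace Dl w)) (w.side (lat σ)) (w.side (lat σ).opp)) := by
  rw [Ne, vertexFunctional_printed_isthmus_root_eq_zero_iff_outerRoot hθ Dl w σ hw hh hO,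
    ← isEmpty_slot_iff_outerRoot Dl w σ hw hh hO, not_isEmpty_iff]

/-- ★★★ **Part 3i's ring theorem on the CLOSED range** (now including the hexagonal point `θ = π/3`, where it
is the tree's F9 datum): at a fully ringed single-plaquette hole the identity fails at the root plaquette for
every `θ ∈ [π/3, 2π/3]`. [cite: DuminilCopinSmirnov2012, proof of Lemma 1] [cite: GlazmanManolescu2019, Lemma 2.1] -/
theorem vertexFunctional_printed_ring_hole_ne_zero_of_mem_Icc {θ : ℝ} (hθ : θ ∈ Set.Icc (π / 3) (2 * π / 3))
    (Dl : List Face) (w : Face) (σ : Side) (hw : w ∈ Dl) (hh : nbr w σ ∉ dom Dl)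
    (hO : OuterRoot (dom Dl) (w.side σ.opp)) (hring : ∀ i ≤ 6, ringFace w σ i ∈ Dl) :
    vertexFunctional (printedWeights θ) tFiveEighths (ybCoeff θ) Dl (w.side σ) w ≠ 0 :=
  (vertexFunctional_printed_isthmus_root_ne_zero_iff_nonempty_of_mem_Icc hθ Dl w σ hw hh hO).2 ⟨ringWalk hring⟩

/-- **Named statement** («the isthmus dichotomy»): for every `θ ∈ [π/3, 2π/3]`, every finite face list
`Dl`, every `w ∈ Dl` and every side `σ` whose outward plaquette is missing while the opposite side of `w` is
an outer root, the Yang–Baxter vertex functional from the root `w.side σ` vanishes at every plaquette of `Dl`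
if and only if `w.side σ` is an outer root. [cite: GlazmanManolescu2019, Lemma 2.1 (the identity for outer roots; here: sharpness of the root hypothesis at isthmuses)] [cite: DuminilCopinSmirnov2012, Lemma 1] -/
def _root_.Literature.Barriers.CriticalPhenomena.PlaquetteWalkIsthmusDichotomy : Prop :=
  ∀ θ : ℝ, θ ∈ Set.Icc (π / 3) (2 * π / 3) → ∀ (Dl : List Face) (w : Face) (σ : Side),
    w ∈ Dl → nbr w σ ∉ dom Dl → OuterRoot (dom Dl) (w.side σ.opp) →
      ((∀ f₀ ∈ Dl, vertexFunctional (printedWeights θ) tFiveEighths (ybCoeff θ) Dl (w.side σ) f₀ = 0) ↔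
        OuterRoot (dom Dl) (w.side σ))

/-- The isthmus dichotomy holds. [cite: GlazmanManolescu2019, Lemma 2.1] [cite: DuminilCopinSmirnov2012, Lemma 1] -/
theorem _root_.Literature.Barriers.CriticalPhenomena.PlaquetteWalkIsthmusDichotomy_holds :
    PlaquetteWalkIsthmusDichotomy :=
  fun _ hθ Dl w σ hw hh hO => vertexFunctional_printed_isthmus_eq_zero_forall_iff_outerRoot hθ Dl w σ hw hh hO

/-- The lane's `ring8` instance (the `3 × 3` block minus its centre, hole root = the S side of `w = (1, 2)`):
the root is NOT outer (the missing centre is enclosed), so by the dichotomy the identity fails at `w` for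
every `θ ∈ [π/3, 2π/3]` — now including the hexagonal point, where this is the tree's F9 datum. The two
`OuterRoot` facts are supplied by the caller. [cite: GlazmanManolescu2019, Lemma 2.1] -/
example {θ : ℝ} (hθ : θ ∈ Set.Icc (π / 3) (2 * π / 3))
    (hO : OuterRoot (dom [((0 : ℤ), (0 : ℤ)), (1, 0), (2, 0), (0, 1), (2, 1), (0, 2), (1, 2), (2, 2)])
      (Face.side (1, 2) (Side.opp .S)))
    (hn : ¬OuterRoot (dom [((0 : ℤ), (0 : ℤ)), (1, 0), (2, 0), (0, 1), (2, 1), (0, 2), (1, 2), (2, 2)])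
      (Face.side (1, 2) .S)) :
    vertexFunctional (printedWeights θ) tFiveEighths (ybCoeff θ)
      [((0 : ℤ), (0 : ℤ)), (1, 0), (2, 0), (0, 1), (2, 1), (0, 2), (1, 2), (2, 2)] (Face.side (1, 2) .S) (1, 2) ≠ 0 :=
  vertexFunctional_printed_isthmus_root_ne_zero_of_not_outerRoot hθ _ (1, 2) .S (by decide) (by simp [dom, nbr]) hO hn

end Dichotomy

end Literature.Barriers.CriticalPhenomena.PlaquetteWalk


/-! ## Part 4c — two connected exits carry a class-`B2a` walk (venture lane «pcv-sawmu», b-step0 gen 15)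

`nonempty_twoExitWalk_of_conn` generalises `nonempty_slot_of_not_outerRoot` from the lateral pair
`(lat σ, (lat σ).opp)` of an isthmus to an arbitrary pair of distinct sides `z₁ ≠ z₂` of `w` whose plaquettes
across are edge-connected inside `D ∖ {w}`; `isB2a_exists_of_conn` glues the first-passage arc of `w` in
front (`consWalk`) and reads off the class: at a boundary root `w.side σ`, CONNECTED exits `z₁, z₂ ≠ σ` carry a
walk of class `B2a` at `w`.  This is the converse of `not_isB2a_of_separated`
(`PlaquetteWalkSeparatedExits`): together, «no class-`B2a` walk at `w` ⟺ the plaquettes of `D ∖ {w}` across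
the sides `≠ σ` of `w` are pairwise not edge-connected inside `D ∖ {w}`». -/

namespace Literature.Barriers.CriticalPhenomena.PlaquetteWalk

open Literature.Probability.RandomPlanarGeometry.SAW.YangBaxter

section TwoExitWalk

/-- **A self-avoiding plaquette walk of `D ∖ {w}` with one arc per plaquette joins the sides `z₁ ≠ z₂` of `w`
whenever the plaquettes across them are edge-connected inside `D ∖ {w}`.**
[cite: DuminilCopinSmirnov2012, proof of Lemma 1] [cite: GlazmanManolescu2019, §1] -/
theorem nonempty_twoExitWalk_of_conn (Dl : List Face) (w : Face) {z₁ z₂ : Side} (hz : z₁ ≠ z₂)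
    (hmem : nbr w z₁ ∈ dom (eraseFace Dl w))
    (hc : Conn (dom (eraseFace Dl w)) (nbr w z₁) (nbr w z₂)) :
    ∃ δ : YBWalk (dom (eraseFace Dl w)) (w.side z₁) (w.side z₂),
      (arcsOf δ.mids).Pairwise fun p q => arcFace p ≠ arcFace q := by
  classical
  obtain ⟨n, g, h0, hlast, hA, hadj, hinj⟩ := exists_min_chain hc hmem
  -- `n ≥ 1`: the two exit neighbours differ
  have hn1 : 1 ≤ n := by
    rcases Nat.eq_zero_or_pos n with hz0 | hz0
    · subst hz0
      exact absurd (nbr_side_inj (h0.symm.trans hlast)) hz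
    · exact hz0
  -- directions along the chain
  have hsd0 : ∀ i, ∃ s : Side, i < n → g (i + 1) = nbr (g i) s := by
    intro i
    by_cases hi : i < n
    · obtain ⟨s, hs⟩ := hadj i hi; exact ⟨s, fun _ => hs⟩
    · exact ⟨z₁, fun h => absurd h hi⟩
  choose sd hsd using hsd0
  -- abbreviations
  set F : ℕ → Face := chainFace w n g with hF
  set t : ℕ → Side := fun i => if i = 0 then z₁ else if i ≤ n then sd (i - 1) else z₂.opp with ht
  set v : ℕ → MidEdge := fun i => (F i).side (t i) with hv
  have hF0 : F 0 = w := by simp [hF, chainFace]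
  have hFsucc : ∀ i ≤ n, F (i + 1) = g i := fun i hi => by
    simp [hF, chainFace, show i + 1 ≤ n + 1 from by omega]
  have hFlast : F (n + 2) = w := by simp [hF, chainFace]
  have ht0 : t 0 = z₁ := by simp [ht]
  have htmid : ∀ i, 1 ≤ i → i ≤ n → t i = sd (i - 1) := fun i h1 h2 => by
    simp [ht, show i ≠ 0 from by omega, h2]
  have htlast : t (n + 1) = z₂.opp := by simp [ht, show ¬(n + 1 ≤ n) from by omega]
  have hv_def : ∀ i, v i = (F i).side (t i) := fun i => rfl
  -- consecutive plaquettes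
  have hstep : ∀ i ≤ n + 1, F (i + 1) = nbr (F i) (t i) := by
    intro i hi
    rcases Nat.eq_zero_or_pos i with rfl | hpos
    · rw [zero_add, hFsucc 0 (by omega), hF0, ht0, h0]
    · rcases Nat.lt_or_ge i (n + 1) with hlt | hge
      · rw [hFsucc i (by omega), show i = (i - 1) + 1 from by omega, hFsucc (i - 1) (by omega),
          show i - 1 + 1 = i from by omega, htmid i hpos (by omega)]
        have e := hsd (i - 1) (by omega)
        rwa [show i - 1 + 1 = i from by omega] at e
      · have hi' : i = n + 1 := by omega
        subst hi'
        rw [hFlast, hFsucc n le_rfl, htlast, hlast]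
        exact (nbr_nbr_opp₄ w z₂).symm
  -- membership and injectivity on `[1, n+1]`, `F 0 = w`
  have hFA : ∀ i, 1 ≤ i → i ≤ n + 1 → F i ∈ dom (eraseFace Dl w) := by
    intro i h1 h2
    rw [show i = (i - 1) + 1 from by omega, hFsucc (i - 1) (by omega)]
    exact hA (i - 1) (by omega)
  have hFne : ∀ i, 1 ≤ i → i ≤ n + 1 → F i ≠ w := fun i h1 h2 => (mem_eraseFace₄.1 (hFA i h1 h2)).2
  have hFinj : ∀ i j, i ≤ n + 1 → j ≤ n + 1 → F i = F j → i = j := by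
    intro i j hi hj e
    rcases Nat.eq_zero_or_pos i with rfl | hip <;> rcases Nat.eq_zero_or_pos j with rfl | hjp
    · rfl
    · exact absurd (hF0.symm.trans e).symm (hFne j hjp hj)
    · exact absurd (e.trans hF0) (hFne i hip hi)
    · rw [show i = (i - 1) + 1 from by omega, hFsucc (i - 1) (by omega),
        show j = (j - 1) + 1 from by omega, hFsucc (j - 1) (by omega)] at e
      have := hinj (i - 1) (j - 1) (by omega) (by omega) e
      omega
  -- `F (i+2) ≠ F i` (no immediate return), including the wrap-around at the end
  have hFskip : ∀ i ≤ n, F (i + 2) ≠ F i := by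
    intro i hi e
    rcases Nat.lt_or_ge (i + 2) (n + 2) with hlt | hge
    · exact absurd (hFinj _ _ (by omega) (by omega) e) (by omega)
    · have hi' : i = n := by omega
      subst hi'
      rw [hFlast] at e
      exact hFne i hn1 (by omega) e.symm
  -- entry and exit sides differ
  have htne : ∀ i ≤ n, (t i).opp ≠ t (i + 1) := by
    intro i hi e
    apply hFskip i hi
    rw [show i + 2 = (i + 1) + 1 from rfl, hstep (i + 1) (by omega), ← e, hstep i (by omega), nbr_nbr_opp₄]
  -- the entry side of plaquette `i+1` is the exit side of plaquette `i`
  have hv_entry : ∀ i ≤ n + 1, v i = (F (i + 1)).side (t i).opp := by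
    intro i hi
    rw [hv_def, hstep i hi, side_nbr_opp₄]
  -- the arcs
  have harc : ∀ i ≤ n, arcFace (v i, v (i + 1)) = some (F (i + 1)) := by
    intro i hi
    rw [hv_entry i (by omega), hv_def]
    exact arcFace_side_side _ _ _ (htne i hi)
  -- injectivity of the mid-edges
  have hvinj : ∀ i j, i ≤ n + 1 → j ≤ n + 1 → v i = v j → i = j := by
    have aux : ∀ i j, i ≤ n + 1 → j ≤ n + 1 → v i = v j → (F j = F i ∨ F j = F (i + 1)) := by
      intro i j hi hj e
      rw [hv_def, hv_def] at e
      rcases eq_or_eq_nbr_of_side_eq₄ e.symm with h | h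
      · exact Or.inl h
      · exact Or.inr (by rw [h, hstep i hi])
    intro i j hi hj e
    rcases aux i j hi hj e with h1 | h1 <;> rcases aux j i hj hi e.symm with h2 | h2
    · exact (hFinj i j hi hj h1.symm)
    · exact (hFinj i j hi hj h1.symm)
    · exact (hFinj i j hi hj h2)
    · -- `F j = F (i+1)` and `F i = F (j+1)`
      exfalso
      rcases Nat.lt_or_ge (i + 1) (n + 2) with hi2 | hi2
      · have hj' : j = i + 1 := hFinj j (i + 1) hj (by omega) h1
        subst hj'
        exact hFskip i (by omega) h2.symm
      · have hi' : i = n + 1 := by omega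
        subst hi'
        rw [hFlast, ← hF0] at h1
        have hj0 : j = 0 := hFinj j 0 hj (by omega) h1
        subst hj0
        rw [zero_add] at h2
        have := hFinj (n + 1) 1 le_rfl (by omega) h2
        omega
  -- the walk
  let δ₀ : YBWalk (dom (eraseFace Dl w)) (v 0) (v (n + 1)) :=
    YBWalk.ofFn (D := dom (eraseFace Dl w)) (n + 1) v hvinj
      (fun i hi => ⟨F (i + 1), hFA (i + 1) (by omega) (by omega), harc i (by omega)⟩)
      (by
        intro i hi e
        rw [harc i (by omega), harc (i + 1) (by omega)] at e
        have := hFinj (i + 1) (i + 2) (by omega) (by omega) (Option.some_injective _ e)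
        omega)
      (by
        intro i j hi hj f hWE hSN
        -- no two crossing straight arcs: each plaquette carries one arc
        have hfi : f = F (i + 1) := by
          have h1 : arcFace (v i, v (i + 1)) = some f := by
            rcases hWE with h | h <;> rw [h] <;> exact arcFace_side_side f _ _ (by decide)
          rw [harc i (by omega)] at h1
          exact (Option.some_injective _ h1).symm
        have hfj : f = F (j + 1) := by
          have h1 : arcFace (v j, v (j + 1)) = some f := by
            rcases hSN with h | h <;> rw [h] <;> exact arcFace_side_side f _ _ (by decide)
          rw [harc j (by omega)] at h1
          exact (Option.some_injective _ h1).symm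
        have hij : i = j := by
          have := hFinj (i + 1) (j + 1) (by omega) (by omega) (hfi.symm.trans hfj); omega
        subst hij
        rcases hWE with h | h <;> rcases hSN with h' | h' <;>
          exact absurd ((Face.side_injective f (Prod.mk.inj (h.symm.trans h')).1)) (by decide))
  have hstart : v 0 = w.side z₁ := by rw [hv_def, hF0, ht0]
  have hend : v (n + 1) = w.side z₂ := by
    rw [hv_def, hFsucc n le_rfl, htlast, hlast]
    exact side_nbr_opp₄ w z₂
  refine ⟨δ₀.cast hstart hend, ?_⟩
  -- one arc per plaquette
  rw [YBWalk.cast_mids, YBWalk.ofFn_mids, List.pairwise_iff_getElem]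
  intro i j hi hj hij
  rw [arcsOf_length, List.length_ofFn] at hi hj
  rw [arcsOf_getElem, arcsOf_getElem]
  simp only [List.getElem_ofFn]
  rw [harc i (by omega), harc j (by omega)]
  intro e
  have := hFinj (i + 1) (j + 1) (by omega) (by omega) (Option.some_injective _ e)
  omega


end TwoExitWalk

section Converse

open private IsB2a IsB2 returnHit_memG returnHit_leG
  from Literature.Probability.RandomPlanarGeometry.YangBaxterSAWGeneralDomain
open private consWalk_mids from Literature.Barriers.CriticalPhenomena.PlaquetteWalkIsthmusRoot

/-- An interior mid-edge of a walk of `D ∖ {w}` is not a side of `w` (both its plaquettes are arc plaquettes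
of the walk, hence `≠ w`). [folklore] -/
private theorem nth_interior_ne_side {Dl : List Face} {w : Face} {x y : MidEdge}
    (δ : YBWalk (dom (eraseFace Dl w)) x y) {j : ℕ} (h0 : 0 < j) (hj : j < δ.arcs.length) (u : Side) :
    δ.nth j ≠ w.side u := by
  intro e
  obtain ⟨j', rfl⟩ : ∃ j', j = j' + 1 := ⟨j - 1, by omega⟩
  have hA := (YBWalk.arcFace_arcAt (γ := δ) (show j' < δ.arcs.length by omega)).2
  have hB := (YBWalk.arcFace_arcAt (γ := δ) hj).2
  have s1 := (YBWalk.side_sIn (γ := δ) (show j' < δ.arcs.length by omega)).2.1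
  have s2 := (YBWalk.side_sIn (γ := δ) hj).1
  have hne := YBWalk.fc_succ_ne (γ := δ) hj
  have em : δ.nth (j' + 1) = δ.mids[j' + 1]'(by have := δ.length_eq; omega) :=
    δ.nth_eq_getElem (by have := δ.length_eq; omega)
  -- `w.side u = (fc (j'+1)).side (sIn (j'+1))`
  have e2 : (δ.fc (j' + 1)).side (δ.sIn (j' + 1)) = w.side u := by rw [s2, ← em, e]
  have hw1 : w ≠ δ.fc (j' + 1) := fun h => (mem_eraseFace₄.1 hB).2 h.symm
  have hw2 : w ≠ δ.fc j' := fun h => (mem_eraseFace₄.1 hA).2 h.symm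
  -- `w = nbr (fc (j'+1)) (sIn (j'+1))` and `fc j' = nbr (fc (j'+1)) (sIn (j'+1))`
  rcases eq_or_eq_nbr_of_side_eq₄ e2.symm with h | h
  · exact hw1 h
  · have e1 : (δ.fc j').side (δ.sOut j') = (δ.fc (j' + 1)).side (δ.sIn (j' + 1)) := by rw [s2, s1]
    rcases eq_or_eq_nbr_of_side_eq₄ e1 with h' | h'
    · exact hne h'
    · exact hw2 (h.trans h'.symm)

/-- ★ **The converse of `not_isB2a_of_separated`: connected exits ⇒ a class-`B2a` walk.**  At a boundary root `w.side σ` (the plaquette across `σ` missing), if the plaquettes across two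
distinct sides `z₁ ≠ z₂` of `w`, both `≠ σ`, are edge-connected inside `D ∖ {w}`, then some walk from
`w.side σ` is of class `B2a` at `w`: the first-passage arc `σ → z₁` in `w` followed by the two-exit walk of
`nonempty_twoExitWalk_of_conn`, re-entering `w` through `z₂`. [cite: DuminilCopinSmirnov2012, proof of Lemma 1]
[cite: GlazmanManolescu2019, §1] -/
theorem isB2a_exists_of_conn (Dl : List Face) (w : Face) (σ : Side) (hw : w ∈ Dl) (hh : nbr w σ ∉ dom Dl)
    {z₁ z₂ : Side} (hz : z₁ ≠ z₂) (h1 : z₁ ≠ σ) (hmem : nbr w z₁ ∈ dom (eraseFace Dl w))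
    (hc : Conn (dom (eraseFace Dl w)) (nbr w z₁) (nbr w z₂)) :
    ∃ ω : ΩG (dom Dl) (w.side σ) w, IsB2a ω := by
  classical
  obtain ⟨δ, -⟩ := nonempty_twoExitWalk_of_conn Dl w hz hmem hc
  let γ : YBWalk (dom Dl) (w.side σ) (w.side z₂) := consWalk hw hh h1 δ
  have hmids : γ.mids = w.side σ :: δ.mids := consWalk_mids hw hh h1 δ
  have hlen : γ.arcs.length = δ.arcs.length + 1 := by
    have h1' := γ.length_eq
    have h2' := δ.length_eq
    rw [hmids, List.length_cons] at h1'
    omega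
  -- `δ` has an arc since `z₁ ≠ z₂`
  have hδpos : 0 < δ.arcs.length := by
    by_contra h0
    have e := δ.nth_length
    rw [show δ.arcs.length = 0 by omega, δ.nth_zero] at e
    exact hz (Face.side_injective w e)
  -- the first hit of `w` is immediate
  have hfh : γ.firstHitG (r := w) = 0 := by
    apply Nat.le_zero.1
    unfold YBWalk.firstHitG
    apply Finset.min'_le
    rw [YBWalk.mem_hitIdx]
    exact ⟨Nat.zero_le _, σ, γ.nth_zero⟩
  have hB2 : γ.firstHitG (r := w) + 1 < γ.arcs.length := by rw [hfh, hlen]; omega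
  -- the mid-edges of `γ` after the root are those of `δ`
  have hnth : ∀ i, i < δ.mids.length → γ.nth (i + 1) = δ.nth i := by
    intro i hi
    rw [γ.nth_eq_getElem (by rw [hmids, List.length_cons]; omega), δ.nth_eq_getElem hi]
    simp [hmids]
  -- no hit strictly between the exit and the end
  have key : γ.returnHitG (r := w) hB2 = γ.arcs.length := by
    have hm := returnHit_memG γ (r := w) hB2
    have hle := returnHit_leG γ (r := w) hB2
    by_contra hne
    have hlt : γ.returnHitG hB2 < γ.arcs.length := lt_of_le_of_ne hle hne
    obtain ⟨-, u, hu⟩ := (YBWalk.mem_hitIdx (γ := γ) (r := w)).1 hm.1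
    have hR1 : 1 < γ.returnHitG hB2 := by have := hm.2; rw [hfh] at this; omega
    rw [show γ.returnHitG hB2 = (γ.returnHitG hB2 - 1) + 1 from by omega,
      hnth _ (by have := δ.length_eq; omega)] at hu
    exact nth_interior_ne_side δ (by omega) (by omega) u hu
  exact ⟨⟨z₂, γ⟩, Exists.intro hB2 key⟩

/-- ★★ **Characterisation at a boundary root's own plaquette** (with `not_isB2a_of_separated` of
`PlaquetteWalkSeparatedExits`): there is NO class-`B2a` walk at `w` iff the plaquettes of `D ∖ {w}` across the
sides `≠ σ` of `w` are pairwise NOT edge-connected inside `D ∖ {w}`.  (Only the «if» direction needs the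
separation of ALL pairs; this is the «only if» half, contrapositive of `isB2a_exists_of_conn`.)
[cite: DuminilCopinSmirnov2012, proof of Lemma 1] [cite: GlazmanManolescu2019, §1] -/
theorem separated_of_forall_not_isB2a (Dl : List Face) (w : Face) (σ : Side) (hw : w ∈ Dl)
    (hh : nbr w σ ∉ dom Dl) (hno : ∀ ω : ΩG (dom Dl) (w.side σ) w, ¬IsB2a ω)
    {z₁ z₂ : Side} (hz : z₁ ≠ z₂) (h1 : z₁ ≠ σ) (hmem : nbr w z₁ ∈ dom (eraseFace Dl w)) :
    ¬Conn (dom (eraseFace Dl w)) (nbr w z₁) (nbr w z₂) := fun hc => by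
  obtain ⟨ω, hω⟩ := isB2a_exists_of_conn Dl w σ hw hh hz h1 hmem hc
  exact hno ω hω

end Converse


end Literature.Barriers.CriticalPhenomena.PlaquetteWalk


/-! ## Part 4d — the characterisation at a boundary root's own plaquette (venture lane «pcv-sawmu», b-step0 gen 15;
glue lemmas after b-ref g55's custody cell)

`no_isB2a_iff_separated`: with `not_isB2a_of_separated` of `PlaquetteWalkSeparatedExits` (⇐) and Part 4c's
`separated_of_forall_not_isB2a` (⇒): at a boundary root `w.side σ` (plaquette across `σ` missing), NO walk from
`w.side σ` is of class `B2a` at `w` iff the plaquettes of `D ∖ {w}` across the sides `≠ σ` of `w` are pairwise NOT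
edge-connected inside `D ∖ {w}`.  The analytic statement stays one-directional: separated ⇒ no excursion ⇒ the
vertex functional vanishes (Part 6a); connected exits give SOME class-`B2a` walk, which may well be unwound. -/

namespace Literature.Barriers.CriticalPhenomena.PlaquetteWalk

section Characterisation

open Literature.Probability.RandomPlanarGeometry.SAW.YangBaxter

open private IsB2a from Literature.Probability.RandomPlanarGeometry.YangBaxterSAWGeneralDomain

/-- The erased face list as a set: `dom (eraseFace Dl w) = dom Dl ∖ {w}`. [folklore] -/
private theorem dom_eraseFace_eq (Dl : List Face) (w : Face) : dom (eraseFace Dl w) = dom Dl \ {w} := by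
  ext f; simp [dom, eraseFace]

/-- A boundary root (`w ∈ Dl`, the plaquette across `σ` missing) is a `RootedFace`. [cite: GlazmanManolescu2019, §1] -/
theorem rootedFace_of_nbr_not_mem {Dl : List Face} {w : Face} {σ : Side} (hw : w ∈ Dl) (hh : nbr w σ ∉ dom Dl) :
    RootedFace (dom Dl) (w.side σ) w :=
  ⟨hw, fun h => by rcases faces_side_eq₄ w σ with e | e <;> rw [e] at h <;> [exact hh h.1; exact hh h.2]⟩

/-- Part 4's edge-connectivity `Conn` is the reflexive–transitive closure used by `PlaquetteWalkSeparatedExits`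
(walks pass from rhombus to rhombus across edges). [cite: GlazmanManolescu2019, §1] -/
theorem conn_iff_reflTransGen (A : Set Face) (f g : Face) :
    Conn A f g ↔ Relation.ReflTransGen (fun f g : Face => (∃ s : Side, g = nbr f s) ∧ f ∈ A ∧ g ∈ A) f g :=
  Iff.rfl

/-- ★★ **The characterisation of «no excursion» at a boundary root's own plaquette**: no walk from `w.side σ` is
of class `B2a` at `w` iff the plaquettes of `D ∖ {w}` across any two distinct sides `≠ σ` of `w` are NOT
edge-connected inside `D ∖ {w}`. [cite: DuminilCopinSmirnov2012, proof of Lemma 1]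
[cite: Glazman2015WeightedSAW, Lemma 3.1 (proof, p. 6: the classes of walks through a rhombus)] -/
theorem no_isB2a_iff_separated (Dl : List Face) (w : Face) (σ : Side) (hw : w ∈ Dl) (hh : nbr w σ ∉ dom Dl) :
    (∀ ω : ΩG (dom Dl) (w.side σ) w, ¬IsB2a ω) ↔
      ∀ z₁ z₂ : Side, z₁ ≠ z₂ → z₁ ≠ σ → z₂ ≠ σ →
        ¬Conn (dom Dl \ {w}) (nbr w z₁) (nbr w z₂) := by
  constructor
  · intro hno z₁ z₂ hz h1 _ hc
    by_cases hmem : nbr w z₁ ∈ dom (eraseFace Dl w)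
    · exact separated_of_forall_not_isB2a Dl w σ hw hh hno hz h1 hmem (by rw [dom_eraseFace_eq]; exact hc)
    · rcases hc.cases_head with e | ⟨c, ⟨-, hf, -⟩, -⟩
      · exact hz (nbr_side_inj e)
      · exact hmem (by rw [dom_eraseFace_eq]; exact hf)
  · intro hsep ω
    exact not_isB2a_of_separated (rootedFace_of_nbr_not_mem hw hh) (fun z₁ z₂ hz h1 h2 => hsep z₁ z₂ hz h1 h2) ω

end Characterisation

end Literature.Barriers.CriticalPhenomena.PlaquetteWalk
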